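import Mathlib
import Literature.MathematicalPhysics.StatisticalMechanics.BoltzmannB4HardSpheresProofs
import HarnessLib

/-!
# Boltzmann's fourth virial coefficient of hard spheres — Part 4: the complete star in closed form

This file finishes the discharge of the named fact
`Literature.MathematicalPhysics.StatisticalMechanics.Boltzmann1899_B4_hardSpheres_dim3`
(`B₄/B₂³ = 2707/4480 + (219/2240)(√2/π) − (4131/4480)(arccos(1/3)/π)` for hard spheres in `D = 3`).

`BoltzmannB4HardSpheresProofs` (Parts 1–3) proved the ring and diamond diagram volumes exactly and reduced
the complete star to `vol(star) = (16π/3) ∫_{1/2}^1 ∫_{1/2}^1 (gs u v + go u v) dv du`, where `gs`, `go`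
are areas of planar disc-pair intersections (Lyberg's reduction of `χ(1)` to a two-dimensional integral,
[Lyberg2005, §3], specialised to `n = 1`, i.e. `D = 3`).  Here:

* Part 4a: pointwise closed forms of `gs`/`go` (triangle case via Heron, cap case);
* Parts 4b–4e: three elementary-calculus layers with explicit antiderivatives — `BoltzmannB4.IS`
  (same-side inner integral on the region `H > 0`), `BoltzmannB4.IOp` (opposite-side inner integral),
  `BoltzmannB4.OUT` (outer integral `G`, with `G(1) − G(1/2)` evaluated in closed form);
* Parts 4f–4j: the bridges, the fundamental-theorem-of-calculus steps, the closed form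
  `vol(star) = (16π/3)((459/1120)π arccos(1/3) − (73/1680)π√2 − (89/1260)π²)` and the final assembly
  `Boltzmann1899_B4_hardSpheres_dim3_holds`.

Sources: Lyberg, *J. Stat. Phys.* 119 (2005) §§3–4 and Table I (`D = 3` value, agreeing with
Boltzmann 1899 / Nijboer–van Hove 1952); the elementary antiderivatives are ours (computer-algebra
assisted, certified by `ring`).  Not here: general odd `D`, the `B₅+` coefficients.
-/

noncomputable section

open _root_.MeasureTheory _root_.Set _root_.Metric _root_.Real intervalIntegral
open scoped Pointwise ENNReal

namespace Literature.MathematicalPhysics.StatisticalMechanics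


/-! ## Part 4a: pointwise closed forms of `gs`, `go` (Heron / triangle vs. cap case) -/

namespace BoltzmannB4

/-- from `H > 0` and positivity, the three triangle inequalities [folklore] -/
theorem triangle_of_H_pos {p q s : ℝ} (hp : 0 < p) (hq : 0 < q) (hs : 0 < s)
    (hH : 0 < (p + q + s) * (-p + q + s) * (p - q + s) * (p + q - s)) :
    s < p + q ∧ p < q + s ∧ q < p + s := by
  by_contra hcon
  rw [not_and_or, not_and_or] at hcon
  rcases hcon with h | h | h <;> push Not at h
  · have h1 : p + q - s ≤ 0 := by linarith
    have h2 : 0 ≤ -p + q + s := by linarith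
    have h3 : 0 ≤ p - q + s := by linarith
    have : (p + q + s) * (-p + q + s) * (p - q + s) * (p + q - s) ≤ 0 :=
      mul_nonpos_of_nonneg_of_nonpos (by positivity) h1
    linarith
  · have h1 : -p + q + s ≤ 0 := by linarith
    have h2 : 0 ≤ p - q + s := by linarith
    have h3 : 0 ≤ p + q - s := by linarith
    have : (p + q + s) * (-p + q + s) * (p - q + s) * (p + q - s) ≤ 0 := by
      have : (p + q + s) * (-p + q + s) ≤ 0 := mul_nonpos_of_nonneg_of_nonpos (by positivity) h1
      have := mul_nonpos_of_nonpos_of_nonneg (mul_nonpos_of_nonpos_of_nonneg this h2) h3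
      linarith
    linarith
  · have h1 : p - q + s ≤ 0 := by linarith
    have h2 : 0 ≤ -p + q + s := by linarith
    have h3 : 0 ≤ p + q - s := by linarith
    have : (p + q + s) * (-p + q + s) * (p - q + s) * (p + q - s) ≤ 0 := by
      have : 0 ≤ (p + q + s) * (-p + q + s) := by positivity
      have := mul_nonneg_of_nonpos_of_nonpos (mul_nonpos_of_nonneg_of_nonpos this h1) (le_refl 0)
      have := mul_nonpos_of_nonpos_of_nonneg (mul_nonpos_of_nonneg_of_nonpos (by positivity : 0 ≤ (p + q + s) * (-p + q + s)) h1) h3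
      linarith
    linarith

/-- Heron: `4PQ − (P+Q−W)²` factors through the square roots [folklore] -/
theorem heron_sqrt {P Q W : ℝ} (hP : 0 ≤ P) (hQ : 0 ≤ Q) (hW : 0 ≤ W) :
    4 * P * Q - (P + Q - W) ^ 2 =
      (Real.sqrt P + Real.sqrt Q + Real.sqrt W) * (-Real.sqrt P + Real.sqrt Q + Real.sqrt W) *
        (Real.sqrt P - Real.sqrt Q + Real.sqrt W) * (Real.sqrt P + Real.sqrt Q - Real.sqrt W) := by
  have h1 := Real.sq_sqrt hP; have h2 := Real.sq_sqrt hQ; have h3 := Real.sq_sqrt hW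
  set p := Real.sqrt P; set q := Real.sqrt Q; set s := Real.sqrt W
  rw [← h1, ← h2, ← h3]; ring

/-- **same side, triangle region**: `gs = Mtri` [folklore] -/
theorem gs_eq_Mtri {u v : ℝ} (hu : u ∈ Ioo (1/2 : ℝ) 1) (hv : v ∈ Ioo (1/2 : ℝ) 1)
    (hH : 0 < 3 - 4 * u ^ 2 - 4 * v ^ 2 + 4 * u * v) :
    gs u v = Mtri (Real.sqrt (1 - u ^ 2)) (Real.sqrt (1 - v ^ 2)) (Real.sqrt (1 - (u - v) ^ 2)) := by
  obtain ⟨hu1, hu2⟩ := hu; obtain ⟨hv1, hv2⟩ := hv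
  have hP : 0 < 1 - u ^ 2 := by nlinarith
  have hQ : 0 < 1 - v ^ 2 := by nlinarith
  have hW : 0 < 1 - (u - v) ^ 2 := by nlinarith
  have htri := triangle_of_H_pos (Real.sqrt_pos.mpr hP) (Real.sqrt_pos.mpr hQ) (Real.sqrt_pos.mpr hW)
    (by rw [← heron_sqrt hP.le hQ.le hW.le]; nlinarith)
  simp only [gs, Gs]
  rw [volume_DP_eq hP hQ hW, volume_DPE_tri (Real.sqrt_pos.mpr hP) (Real.sqrt_pos.mpr hQ)
    (Real.sqrt_pos.mpr hW) htri.1 htri.2.1 htri.2.2, ENNReal.toReal_ofReal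
    (Mtri_nonneg (Real.sqrt_pos.mpr hP) (Real.sqrt_pos.mpr hQ) (Real.sqrt_pos.mpr hW)
      htri.1 htri.2.1 htri.2.2)]

/-- `H ≤ 0` together with `p, q < s` forces the cap case `s ≥ p + q` [folklore] -/
theorem cap_of_H_nonpos {p q s : ℝ} (hps : p < s) (hqs : q < s)
    (hH : (p + q + s) * (-p + q + s) * (p - q + s) * (p + q - s) ≤ 0) : p + q ≤ s := by
  by_contra h
  push Not at h
  have h1 : 0 < -p + q + s := by linarith
  have h2 : 0 < p - q + s := by linarith
  have h3 : 0 < p + q - s := by linarith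
  have h0 : 0 < p + q + s := by linarith
  have := mul_pos (mul_pos (mul_pos h0 h1) h2) h3
  linarith

/-- **same side, cap region**: `gs = π² P Q` [folklore] -/
theorem gs_eq_cap {u v : ℝ} (hu : u ∈ Ioo (1/2 : ℝ) 1) (hv : v ∈ Ioo (1/2 : ℝ) 1)
    (hH : 3 - 4 * u ^ 2 - 4 * v ^ 2 + 4 * u * v ≤ 0) :
    gs u v = π ^ 2 * (1 - u ^ 2) * (1 - v ^ 2) := by
  obtain ⟨hu1, hu2⟩ := hu; obtain ⟨hv1, hv2⟩ := hv
  have hP : 0 < 1 - u ^ 2 := by nlinarith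
  have hQ : 0 < 1 - v ^ 2 := by nlinarith
  have hW : 0 < 1 - (u - v) ^ 2 := by nlinarith
  have hp0 : 0 < Real.sqrt (1 - u ^ 2) := Real.sqrt_pos.mpr hP
  have hq0 : 0 < Real.sqrt (1 - v ^ 2) := Real.sqrt_pos.mpr hQ
  have hs0 : 0 < Real.sqrt (1 - (u - v) ^ 2) := Real.sqrt_pos.mpr hW
  have hp2 : Real.sqrt (1 - u ^ 2) ^ 2 = 1 - u ^ 2 := Real.sq_sqrt hP.le
  have hq2 : Real.sqrt (1 - v ^ 2) ^ 2 = 1 - v ^ 2 := Real.sq_sqrt hQ.le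
  have hs2 : Real.sqrt (1 - (u - v) ^ 2) ^ 2 = 1 - (u - v) ^ 2 := Real.sq_sqrt hW.le
  -- p, q < √3/2 < s
  have hps : Real.sqrt (1 - u ^ 2) < Real.sqrt (1 - (u - v) ^ 2) :=
    lt_of_pow_lt_pow_left₀ 2 hs0.le (by rw [hp2, hs2]; nlinarith)
  have hqs : Real.sqrt (1 - v ^ 2) < Real.sqrt (1 - (u - v) ^ 2) :=
    lt_of_pow_lt_pow_left₀ 2 hs0.le (by rw [hq2, hs2]; nlinarith)
  have hheron := heron_sqrt hP.le hQ.le hW.le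
  have hH' : 4 * (1 - u ^ 2) * (1 - v ^ 2) - ((1 - u ^ 2) + (1 - v ^ 2) - (1 - (u - v) ^ 2)) ^ 2 ≤ 0 := by
    nlinarith [hH]
  rw [hheron] at hH'
  have hcap := cap_of_H_nonpos hps hqs hH'
  simp only [gs, Gs]
  rw [volume_DP_eq hP hQ hW, volume_DPE_cap hp0 hq0 hcap, ENNReal.toReal_ofReal (by positivity), hp2, hq2]

/-- **opposite side**: `go = Mtri` [folklore] -/
theorem go_eq_Mtri {u v : ℝ} (hu : u ∈ Ioo (1/2 : ℝ) 1) (hv : v ∈ Ioo (1/2 : ℝ) 1) :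
    go u v = Mtri (Real.sqrt (1 - u ^ 2)) (Real.sqrt (1 - v ^ 2)) (Real.sqrt (1 - (u + v - 1) ^ 2)) := by
  obtain ⟨hu1, hu2⟩ := hu; obtain ⟨hv1, hv2⟩ := hv
  have hP : 0 < 1 - u ^ 2 := by nlinarith
  have hQ : 0 < 1 - v ^ 2 := by nlinarith
  have hW : 0 < 1 - (u + v - 1) ^ 2 := by nlinarith
  have hHopp : 4 * (1 - u ^ 2) * (1 - v ^ 2) - ((1 - u ^ 2) + (1 - v ^ 2) - (1 - (u + v - 1) ^ 2)) ^ 2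
      = 8 * (1 - u) * (1 - v) * (u + v) := by ring
  have htri := triangle_of_H_pos (Real.sqrt_pos.mpr hP) (Real.sqrt_pos.mpr hQ) (Real.sqrt_pos.mpr hW)
    (by
      rw [← heron_sqrt hP.le hQ.le hW.le, hHopp]
      have : 0 < 1 - u := by linarith
      have : 0 < 1 - v := by linarith
      positivity)
  simp only [go, Go]
  rw [volume_DP_eq hP hQ hW, volume_DPE_tri (Real.sqrt_pos.mpr hP) (Real.sqrt_pos.mpr hQ)
    (Real.sqrt_pos.mpr hW) htri.1 htri.2.1 htri.2.2, ENNReal.toReal_ofReal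
    (Mtri_nonneg (Real.sqrt_pos.mpr hP) (Real.sqrt_pos.mpr hQ) (Real.sqrt_pos.mpr hW)
      htri.1 htri.2.1 htri.2.2)]

end BoltzmannB4


namespace BoltzmannB4

/-- the chord term of `lensArea` at square-root arguments is `√H/2` [folklore] -/
theorem chord_sqrt {A B D : ℝ} (hA : 0 < A) (hB : 0 ≤ B) (hD : 0 < D)
    (hH : 0 ≤ 4 * D * A - (D + A - B) ^ 2) :
    Real.sqrt D * Real.sqrt (Real.sqrt A ^ 2 - t0 (Real.sqrt A) (Real.sqrt B) (Real.sqrt D) ^ 2) =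
      Real.sqrt (4 * D * A - (D + A - B) ^ 2) / 2 := by
  have hsD : 0 < Real.sqrt D := Real.sqrt_pos.mpr hD
  rw [t0, Real.sq_sqrt hA.le, Real.sq_sqrt hB, Real.sq_sqrt hD.le]
  have : A - ((D + A - B) / (2 * Real.sqrt D)) ^ 2 = (4 * D * A - (D + A - B) ^ 2) / (2 * Real.sqrt D) ^ 2 := by
    field_simp
    rw [Real.sq_sqrt hD.le]
    ring
  rw [this, Real.sqrt_div hH, Real.sqrt_sq (by positivity)]
  field_simp

/-- **`Mtri` at square roots, in Heron form**:
`Mtri √P √Q √W = π(PQ·A_s + PW·A_q + QW·A_p) − (π/4)(P+Q+W)√H`, `H = 4PQ − (P+Q−W)²`. [folklore] -/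
theorem Mtri_sqrt_eq {P Q W : ℝ} (hP : 0 < P) (hQ : 0 < Q) (hW : 0 < W)
    (hH : 0 ≤ 4 * P * Q - (P + Q - W) ^ 2) :
    Mtri (Real.sqrt P) (Real.sqrt Q) (Real.sqrt W) =
      π * (P * Q * Real.arccos ((P + Q - W) / (2 * Real.sqrt P * Real.sqrt Q)) +
        P * W * Real.arccos ((P + W - Q) / (2 * Real.sqrt P * Real.sqrt W)) +
        Q * W * Real.arccos ((Q + W - P) / (2 * Real.sqrt Q * Real.sqrt W))) -
      π / 4 * (P + Q + W) * Real.sqrt (4 * P * Q - (P + Q - W) ^ 2) := by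
  have hH1 : 0 ≤ 4 * P * Q - (P + Q - W) ^ 2 := hH
  have hH2 : 0 ≤ 4 * Q * P - (Q + P - W) ^ 2 := by nlinarith [hH]
  have hH3 : 0 ≤ 4 * W * Q - (W + Q - P) ^ 2 := by nlinarith [hH]
  have e2 : 4 * Q * P - (Q + P - W) ^ 2 = 4 * P * Q - (P + Q - W) ^ 2 := by ring
  have e3 : 4 * W * Q - (W + Q - P) ^ 2 = 4 * P * Q - (P + Q - W) ^ 2 := by ring
  have c1 := chord_sqrt hQ hW.le hP hH1
  have c2 := chord_sqrt hP hW.le hQ hH2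
  have c3 := chord_sqrt hQ hP.le hW hH3
  rw [e2] at c2; rw [e3] at c3
  simp only [Mtri, lensArea]
  rw [c1, c2, c3, Real.sq_sqrt hP.le, Real.sq_sqrt hQ.le, Real.sq_sqrt hW.le]
  have a1 : (Real.sqrt Q : ℝ) = Real.sqrt Q := rfl
  -- normalise the arccos arguments
  have r1 : (Q + P - W) / (2 * Real.sqrt Q * Real.sqrt P) = (P + Q - W) / (2 * Real.sqrt P * Real.sqrt Q) := by ring_nf
  have r2 : (Q + W - P) / (2 * Real.sqrt Q * Real.sqrt W) = (Q + W - P) / (2 * Real.sqrt Q * Real.sqrt W) := rfl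
  have r3 : (W + Q - P) / (2 * Real.sqrt W * Real.sqrt Q) = (Q + W - P) / (2 * Real.sqrt Q * Real.sqrt W) := by ring_nf
  have r4 : (W + P - Q) / (2 * Real.sqrt W * Real.sqrt P) = (P + W - Q) / (2 * Real.sqrt P * Real.sqrt W) := by ring_nf
  rw [r1, r3, r4]
  ring

end BoltzmannB4



/-! ## Part 4b–4e: the three calculus layers

Following Lyberg (2005, §3) the complete-star integral is reduced to `(16π/3)∫∫(gs+go)`; the two inner
`v`-integrals and the outer `u`-integral are elementary but long.  We give explicit antiderivatives
(`IS.Fs` for the same-side piece on the triangle region `H > 0`, `IOp.Fo` for the opposite-side piece,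
`OUT.G` for the outer integral), verify `F' = integrand` with `HasDerivAt` and close each layer with the
fundamental theorem of calculus.  All coefficient polynomials were obtained with a computer algebra
computation and are certified here by `ring`/`linear_combination`. -/

namespace BoltzmannB4

/-! ### generic calculus helpers -/

/-- derivative of `arccos (N/(2√D))` in terms of `H = 4D − N²` [folklore] -/
theorem hasDerivAt_arccos_quot {N D : ℝ → ℝ} {N' D' v : ℝ} (hN : HasDerivAt N N' v)
    (hD : HasDerivAt D D' v) (hDpos : 0 < D v) (hH : 0 < 4 * D v - N v ^ 2) :
    HasDerivAt (fun x => arccos (N x / (2 * Real.sqrt (D x))))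
      (-(2 * N' * D v - N v * D') / (2 * D v * Real.sqrt (4 * D v - N v ^ 2))) v := by
  set H := 4 * D v - N v ^ 2 with hHdef
  have hsD : 0 < Real.sqrt (D v) := Real.sqrt_pos.mpr hDpos
  have hsD2 : Real.sqrt (D v) ^ 2 = D v := Real.sq_sqrt hDpos.le
  have hsH : 0 < Real.sqrt H := Real.sqrt_pos.mpr hH
  have hsH2 : Real.sqrt H ^ 2 = H := Real.sq_sqrt hH.le
  have hinner : HasDerivAt (fun x => N x / (2 * Real.sqrt (D x)))
      ((N' * (2 * Real.sqrt (D v)) - N v * (2 * (D' / (2 * Real.sqrt (D v))))) /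
        (2 * Real.sqrt (D v)) ^ 2) v := by
    apply hN.div ((hD.sqrt hDpos.ne').const_mul 2)
    positivity
  set x := N v / (2 * Real.sqrt (D v)) with hx
  have hx2 : x ^ 2 < 1 := by
    rw [hx, div_pow, mul_pow, hsD2]
    rw [div_lt_one (by positivity)]
    nlinarith
  have hxlt : |x| < 1 := by
    rw [← sq_lt_one_iff_abs_lt_one]; exact hx2
  have hx1 : x ≠ -1 := fun h => by rw [h] at hxlt; norm_num at hxlt
  have hx1' : x ≠ 1 := fun h => by rw [h] at hxlt; norm_num at hxlt
  have harc := (Real.hasDerivAt_arccos hx1 hx1').comp v hinner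
  refine harc.congr_deriv ?_
  have hsq : Real.sqrt (1 - x ^ 2) = Real.sqrt H / (2 * Real.sqrt (D v)) := by
    have : 1 - x ^ 2 = H / (2 * Real.sqrt (D v)) ^ 2 := by
      rw [hx, div_pow, mul_pow, hsD2, hHdef]
      field_simp
      ring
    rw [this, Real.sqrt_div hH.le, Real.sqrt_sq (by positivity)]
  rw [hsq]
  field_simp
  rw [hsD2]
  ring

/-- explicit quintic in `v` [folklore] -/
def poly5 (c0 c1 c2 c3 c4 c5 v : ℝ) : ℝ :=
  c0 + c1 * v + c2 * v ^ 2 + c3 * v ^ 3 + c4 * v ^ 4 + c5 * v ^ 5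

/-- derivative formula for `poly5` (B₄ evaluation, calculus layer). [folklore] -/
theorem hasDerivAt_poly5 (c0 c1 c2 c3 c4 c5 v : ℝ) :
    HasDerivAt (poly5 c0 c1 c2 c3 c4 c5)
      (c1 + 2 * c2 * v + 3 * c3 * v ^ 2 + 4 * c4 * v ^ 3 + 5 * c5 * v ^ 4) v := by
  have h := (((((hasDerivAt_const v c0).add ((hasDerivAt_id v).const_mul c1)).add
    ((hasDerivAt_pow 2 v).const_mul c2)).add ((hasDerivAt_pow 3 v).const_mul c3)).add
    ((hasDerivAt_pow 4 v).const_mul c4)).add ((hasDerivAt_pow 5 v).const_mul c5)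
  have hf : ((fun _ => c0) + fun x => c1 * id x) + (fun x => c2 * x ^ 2) + (fun x => c3 * x ^ 3) +
      (fun x => c4 * x ^ 4) + (fun x => c5 * x ^ 5) = poly5 c0 c1 c2 c3 c4 c5 := by
    funext x; simp [poly5]
  rw [hf] at h
  refine h.congr_deriv ?_
  push_cast
  ring


/-- generic: derivative of `arcsin (f v)` when `1 - f² = g²`, `g > 0` [folklore] -/
theorem hasDerivAt_arcsin_comp {f : ℝ → ℝ} {f' g v : ℝ} (hf : HasDerivAt f f' v) (hg : 0 < g)
    (hfg : 1 - f v ^ 2 = g ^ 2) : HasDerivAt (fun x => arcsin (f x)) (f' / g) v := by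
  have hlt : f v ^ 2 < 1 := by nlinarith
  have habs : |f v| < 1 := by rw [← sq_lt_one_iff_abs_lt_one]; exact hlt
  have h1 : f v ≠ -1 := fun h => by rw [h] at habs; norm_num at habs
  have h2 : f v ≠ 1 := fun h => by rw [h] at habs; norm_num at habs
  have := (Real.hasDerivAt_arcsin h1 h2).comp v hf
  refine this.congr_deriv ?_
  rw [hfg, Real.sqrt_sq hg.le]
  field_simp


/-- generic: derivative of `arccos (√(g v))` when `g (1-g) = k²`, `k > 0`, `g > 0` [folklore] -/
theorem hasDerivAt_arccos_sqrt {g : ℝ → ℝ} {g' k v : ℝ} (hg : HasDerivAt g g' v) (hpos : 0 < g v)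
    (hk : 0 < k) (hgk : g v * (1 - g v) = k ^ 2) :
    HasDerivAt (fun x => arccos (Real.sqrt (g x))) (-g' / (2 * k)) v := by
  have hlt1 : g v < 1 := by nlinarith
  have hsg : 0 < Real.sqrt (g v) := Real.sqrt_pos.mpr hpos
  have hsg2 : Real.sqrt (g v) ^ 2 = g v := Real.sq_sqrt hpos.le
  have hx1 : Real.sqrt (g v) ≠ -1 := by intro h; linarith
  have hx2 : Real.sqrt (g v) ≠ 1 := by
    intro h
    have : g v = 1 := by rw [← hsg2, h]; norm_num
    linarith
  have hinner := hg.sqrt hpos.ne'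
  have := (Real.hasDerivAt_arccos hx1 hx2).comp v hinner
  refine this.congr_deriv ?_
  have h1g : Real.sqrt (1 - Real.sqrt (g v) ^ 2) = k / Real.sqrt (g v) := by
    rw [hsg2]
    have : 1 - g v = (k / Real.sqrt (g v)) ^ 2 := by
      rw [div_pow, hsg2]; field_simp; linarith [hgk]
    rw [this, Real.sqrt_sq (by positivity)]
  rw [h1g]
  field_simp


/-- derivative formula for `arccos_comp` (B₄ evaluation, calculus layer). [folklore] -/
theorem hasDerivAt_arccos_comp {f : ℝ → ℝ} {f' g v : ℝ} (hf : HasDerivAt f f' v) (hg : 0 < g)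
    (hfg : 1 - f v ^ 2 = g ^ 2) : HasDerivAt (fun x => arccos (f x)) (-(f' / g)) v := by
  have hlt : f v ^ 2 < 1 := by nlinarith
  have habs : |f v| < 1 := by rw [← sq_lt_one_iff_abs_lt_one]; exact hlt
  have h1 : f v ≠ -1 := fun h => by rw [h] at habs; norm_num at habs
  have h2 : f v ≠ 1 := fun h => by rw [h] at habs; norm_num at habs
  have := (Real.hasDerivAt_arccos h1 h2).comp v hf
  refine this.congr_deriv ?_
  rw [hfg, Real.sqrt_sq hg.le]
  field_simp


/-- derivative formula for `arcsin_sqrt` (B₄ evaluation, calculus layer). [folklore] -/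
theorem hasDerivAt_arcsin_sqrt {g : ℝ → ℝ} {g' k v : ℝ} (hg : HasDerivAt g g' v) (hpos : 0 < g v)
    (hk : 0 < k) (hgk : g v * (1 - g v) = k ^ 2) :
    HasDerivAt (fun x => arcsin (Real.sqrt (g x))) (g' / (2 * k)) v := by
  have hlt1 : g v < 1 := by nlinarith
  have hsg : 0 < Real.sqrt (g v) := Real.sqrt_pos.mpr hpos
  have hsg2 : Real.sqrt (g v) ^ 2 = g v := Real.sq_sqrt hpos.le
  have hx1 : Real.sqrt (g v) ≠ -1 := by intro h; linarith
  have hx2 : Real.sqrt (g v) ≠ 1 := by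
    intro h
    have : g v = 1 := by rw [← hsg2, h]; norm_num
    linarith
  have hinner := hg.sqrt hpos.ne'
  have := (Real.hasDerivAt_arcsin hx1 hx2).comp v hinner
  refine this.congr_deriv ?_
  have h1g : Real.sqrt (1 - Real.sqrt (g v) ^ 2) = k / Real.sqrt (g v) := by
    rw [hsg2]
    have : 1 - g v = (k / Real.sqrt (g v)) ^ 2 := by
      rw [div_pow, hsg2]; field_simp; linarith [hgk]
    rw [this, Real.sqrt_sq (by positivity)]
  rw [h1g]
  field_simp



namespace IS


/-! ### the same-side objects (`u` is a parameter, `v` the variable) -/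

/-- auxiliary quantity `Pf` of the explicit B₄ evaluation (Lyberg's reduction, D = 3). [folklore] -/
def Pf (u : ℝ) : ℝ := 1 - u ^ 2
/-- auxiliary quantity `Qf` of the explicit B₄ evaluation (Lyberg's reduction, D = 3). [folklore] -/
def Qf (v : ℝ) : ℝ := 1 - v ^ 2
/-- auxiliary quantity `Wf` of the explicit B₄ evaluation (Lyberg's reduction, D = 3). [folklore] -/
def Wf (u v : ℝ) : ℝ := 1 - (u - v) ^ 2
/-- auxiliary quantity `Hf` of the explicit B₄ evaluation (Lyberg's reduction, D = 3). [folklore] -/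
def Hf (u v : ℝ) : ℝ := 3 - 4 * u ^ 2 - 4 * v ^ 2 + 4 * u * v
/-- auxiliary quantity `Ns` of the explicit B₄ evaluation (Lyberg's reduction, D = 3). [folklore] -/
def Ns (u v : ℝ) : ℝ := Pf u + Qf v - Wf u v
/-- auxiliary quantity `Nq` of the explicit B₄ evaluation (Lyberg's reduction, D = 3). [folklore] -/
def Nq (u v : ℝ) : ℝ := Pf u + Wf u v - Qf v
/-- auxiliary quantity `Np` of the explicit B₄ evaluation (Lyberg's reduction, D = 3). [folklore] -/
def Np (u v : ℝ) : ℝ := Qf v + Wf u v - Pf u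
/-- auxiliary quantity `Ds` of the explicit B₄ evaluation (Lyberg's reduction, D = 3). [folklore] -/
def Ds (u v : ℝ) : ℝ := Pf u * Qf v
/-- auxiliary quantity `Dq` of the explicit B₄ evaluation (Lyberg's reduction, D = 3). [folklore] -/
def Dq (u v : ℝ) : ℝ := Pf u * Wf u v
/-- auxiliary quantity `Dp` of the explicit B₄ evaluation (Lyberg's reduction, D = 3). [folklore] -/
def Dp (u v : ℝ) : ℝ := Qf v * Wf u v
/-- auxiliary quantity `As` of the explicit B₄ evaluation (Lyberg's reduction, D = 3). [folklore] -/
def As (u v : ℝ) : ℝ := arccos (Ns u v / (2 * Real.sqrt (Ds u v)))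
/-- auxiliary quantity `Aq` of the explicit B₄ evaluation (Lyberg's reduction, D = 3). [folklore] -/
def Aq (u v : ℝ) : ℝ := arccos (Nq u v / (2 * Real.sqrt (Dq u v)))
/-- auxiliary quantity `Ap` of the explicit B₄ evaluation (Lyberg's reduction, D = 3). [folklore] -/
def Ap (u v : ℝ) : ℝ := arccos (Np u v / (2 * Real.sqrt (Dp u v)))
/-- the closed-form integrand [folklore] -/
def Ms (u v : ℝ) : ℝ :=
  π * (Ds u v * As u v + Dq u v * Aq u v + Dp u v * Ap u v) - π / 4 * (Pf u + Qf v + Wf u v) * Real.sqrt (Hf u v)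

/-- auxiliary quantity `Rs` of the explicit B₄ evaluation (Lyberg's reduction, D = 3). [folklore] -/
def Rs (u : ℝ) : ℝ → ℝ := poly5 ((2/3 : ℝ) * u ^ 2 + ((-2)/3 : ℝ)) (((-1) : ℝ) * u ^ 2 + (1 : ℝ)) 0
  ((1/3 : ℝ) * u ^ 2 + ((-1)/3 : ℝ)) 0 0
/-- auxiliary quantity `Rq` of the explicit B₄ evaluation (Lyberg's reduction, D = 3). [folklore] -/
def Rq (u : ℝ) : ℝ → ℝ := poly5 (((-3)/10 : ℝ) * u ^ 5 + (2/3 : ℝ) * u ^ 3 + (2/3 : ℝ) * u ^ 2 + ((-1) : ℝ) * u + ((-2)/5 : ℝ))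
  ((1 : ℝ) * u ^ 4 + ((-2) : ℝ) * u ^ 2 + (1 : ℝ)) (((-1) : ℝ) * u ^ 3 + (1 : ℝ) * u) ((1/3 : ℝ) * u ^ 2 + ((-1)/3 : ℝ)) 0 0
/-- auxiliary quantity `Rp` of the explicit B₄ evaluation (Lyberg's reduction, D = 3). [folklore] -/
def Rp (u : ℝ) : ℝ → ℝ := poly5 ((2/3 : ℝ) * u ^ 2 + ((-1)/2 : ℝ) * u + ((-8)/15 : ℝ)) (((-1) : ℝ) * u ^ 2 + (1 : ℝ))
  ((1 : ℝ) * u) ((1/3 : ℝ) * u ^ 2 + ((-2)/3 : ℝ)) (((-1)/2 : ℝ) * u) (1/5 : ℝ)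
/-- auxiliary quantity `Es` of the explicit B₄ evaluation (Lyberg's reduction, D = 3). [folklore] -/
def Es (u : ℝ) : ℝ → ℝ := poly5 ((3/10 : ℝ) * u ^ 5 + ((-43)/60 : ℝ) * u ^ 3 + (5/12 : ℝ) * u)
  (((-7)/10 : ℝ) * u ^ 4 + (23/15 : ℝ) * u ^ 2 + ((-5)/6 : ℝ)) ((3/10 : ℝ) * u ^ 3 + ((-3)/10 : ℝ) * u)
  (((-1)/5 : ℝ) * u ^ 2 + (1/5 : ℝ)) 0 0
/-- `I₀ = ∫ dv/√H` [folklore] -/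
def I0s (u v : ℝ) : ℝ := 1 / 2 * arcsin ((2 * v - u) / Real.sqrt (3 * Pf u))
/-- `∫ dv/((v+1)√H)` [folklore] -/
def Jms (u v : ℝ) : ℝ :=
  -(1 / (2 * u + 1)) * arcsin (((2 * u + 1) ^ 2 / (v + 1) - 2 * (2 + u)) / (2 * Real.sqrt (3 * Pf u)))
/-- `∫ dv/((1+u−v)√H)` [folklore] -/
def Jps (u v : ℝ) : ℝ :=
  -(1 / (2 * u + 1)) * arcsin (((2 * u + 1) ^ 2 / (v - 1 - u) + 2 * (2 + u)) / (2 * Real.sqrt (3 * Pf u)))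
/-- the antiderivative [folklore] -/
def Fs (u v : ℝ) : ℝ :=
  π * (Rs u v * As u v + Rq u v * Aq u v + Rp u v * Ap u v) +
    π / (2 * Pf u) * (Es u v * Real.sqrt (Hf u v) + (-(38/15 : ℝ) * Pf u) * I0s u v +
      ((4/15 : ℝ) * Pf u * (2 * u + 1)) * (Jms u v + Jps u v))

/-! ### polynomial identities -/
/-- auxiliary identity `Hf_eq_s` of the explicit B₄ evaluation. [folklore] -/
theorem Hf_eq_s (u v : ℝ) : 4 * Ds u v - Ns u v ^ 2 = Hf u v := by
  simp only [Ds, Ns, Hf, Pf, Qf, Wf]; ring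
/-- auxiliary identity `Hf_eq_q` of the explicit B₄ evaluation. [folklore] -/
theorem Hf_eq_q (u v : ℝ) : 4 * Dq u v - Nq u v ^ 2 = Hf u v := by
  simp only [Dq, Nq, Hf, Pf, Qf, Wf]; ring
/-- auxiliary identity `Hf_eq_p` of the explicit B₄ evaluation. [folklore] -/
theorem Hf_eq_p (u v : ℝ) : 4 * Dp u v - Np u v ^ 2 = Hf u v := by
  simp only [Dp, Np, Hf, Pf, Qf, Wf]; ring

/-! ### elementary derivatives in `v` -/
/-- derivative formula for `Qf` (B₄ evaluation, calculus layer). [folklore] -/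
theorem hasDerivAt_Qf (v : ℝ) : HasDerivAt Qf (-(2 * v)) v := by
  have h := ((hasDerivAt_pow 2 v).const_sub 1)
  have hq : Qf = fun x => 1 - x ^ 2 := rfl
  rw [hq]
  refine h.congr_deriv ?_
  simp
/-- derivative formula for `Wf` (B₄ evaluation, calculus layer). [folklore] -/
theorem hasDerivAt_Wf (u v : ℝ) : HasDerivAt (Wf u) (2 * (u - v)) v := by
  have h := (((hasDerivAt_id v).const_sub u).pow 2).const_sub 1
  refine (h.congr_deriv ?_).congr_of_eventuallyEq ?_
  · simp
  · exact Filter.Eventually.of_forall fun x => by simp [Wf]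
/-- derivative formula for `Hf` (B₄ evaluation, calculus layer). [folklore] -/
theorem hasDerivAt_Hf (u v : ℝ) : HasDerivAt (Hf u) (-(8 * v) + 4 * u) v := by
  have h := (((hasDerivAt_pow 2 v).const_mul 4).const_sub (3 - 4 * u ^ 2)).add
    ((hasDerivAt_id v).const_mul (4 * u))
  refine (h.congr_deriv ?_).congr_of_eventuallyEq ?_
  · simp only [Nat.cast_ofNat, mul_one]; ring
  · exact Filter.Eventually.of_forall fun x => by simp [Hf]

/-- derivative formula for `Ns` (B₄ evaluation, calculus layer). [folklore] -/
theorem hasDerivAt_Ns (u v : ℝ) : HasDerivAt (Ns u) (-(2 * u)) v := by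
  have h := ((hasDerivAt_Qf v).const_add (Pf u)).sub (hasDerivAt_Wf u v)
  refine (h.congr_deriv ?_).congr_of_eventuallyEq ?_
  · ring
  · exact Filter.Eventually.of_forall fun x => by simp [Ns]
/-- derivative formula for `Nq` (B₄ evaluation, calculus layer). [folklore] -/
theorem hasDerivAt_Nq (u v : ℝ) : HasDerivAt (Nq u) (2 * u) v := by
  have h := ((hasDerivAt_Wf u v).const_add (Pf u)).sub (hasDerivAt_Qf v)
  refine (h.congr_deriv ?_).congr_of_eventuallyEq ?_
  · ring
  · exact Filter.Eventually.of_forall fun x => by simp [Nq]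
/-- derivative formula for `Np` (B₄ evaluation, calculus layer). [folklore] -/
theorem hasDerivAt_Np (u v : ℝ) : HasDerivAt (Np u) (-(2 * v) + 2 * (u - v)) v := by
  have h := ((hasDerivAt_Qf v).add (hasDerivAt_Wf u v)).sub_const (Pf u)
  refine (h.congr_deriv ?_).congr_of_eventuallyEq ?_
  · ring
  · exact Filter.Eventually.of_forall fun x => by simp [Np]
/-- derivative formula for `Ds` (B₄ evaluation, calculus layer). [folklore] -/
theorem hasDerivAt_Ds (u v : ℝ) : HasDerivAt (Ds u) (Pf u * (-(2 * v))) v := by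
  have h := (hasDerivAt_Qf v).const_mul (Pf u)
  exact h.congr_of_eventuallyEq (Filter.Eventually.of_forall fun x => by simp [Ds])
/-- derivative formula for `Dq` (B₄ evaluation, calculus layer). [folklore] -/
theorem hasDerivAt_Dq (u v : ℝ) : HasDerivAt (Dq u) (Pf u * (2 * (u - v))) v := by
  have h := (hasDerivAt_Wf u v).const_mul (Pf u)
  exact h.congr_of_eventuallyEq (Filter.Eventually.of_forall fun x => by simp [Dq])
/-- derivative formula for `Dp` (B₄ evaluation, calculus layer). [folklore] -/
theorem hasDerivAt_Dp (u v : ℝ) :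
    HasDerivAt (Dp u) (-(2 * v) * Wf u v + Qf v * (2 * (u - v))) v := by
  have h := (hasDerivAt_Qf v).mul (hasDerivAt_Wf u v)
  exact h.congr_of_eventuallyEq (Filter.Eventually.of_forall fun x => by simp [Dp])

/-! ### the key rational identity -/
/-- auxiliary identity `key_identity` of the explicit B₄ evaluation. [folklore] -/
theorem key_identity (u v : ℝ) (hP : Pf u ≠ 0) (hQ : Qf v ≠ 0) (hW : Wf u v ≠ 0) (h1 : v + 1 ≠ 0)
    (h2 : 1 + u - v ≠ 0) :
    -(Rs u v * (2 * (-(2 * u)) * Ds u v - Ns u v * (Pf u * (-(2 * v)))) / (2 * Ds u v) +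
        Rq u v * (2 * (2 * u) * Dq u v - Nq u v * (Pf u * (2 * (u - v)))) / (2 * Dq u v) +
        Rp u v * (2 * (-(2 * v) + 2 * (u - v)) * Dp u v - Np u v * (-(2 * v) * Wf u v + Qf v * (2 * (u - v)))) /
          (2 * Dp u v)) +
      1 / (2 * Pf u) * ((((-7)/10 : ℝ) * u ^ 4 + (23/15 : ℝ) * u ^ 2 + ((-5)/6 : ℝ) +
          2 * ((3/10 : ℝ) * u ^ 3 + ((-3)/10 : ℝ) * u) * v + 3 * (((-1)/5 : ℝ) * u ^ 2 + (1/5 : ℝ)) * v ^ 2 +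
          4 * 0 * v ^ 3 + 5 * 0 * v ^ 4) * Hf u v +
        Es u v * (-(8 * v) + 4 * u) / 2 + (-(38/15 : ℝ) * Pf u) +
        ((4/15 : ℝ) * Pf u * (2 * u + 1)) * (1 / (v + 1) + 1 / (1 + u - v)))
      = -(1 / 4) * (Pf u + Qf v + Wf u v) * Hf u v := by
  have hDs : Ds u v ≠ 0 := mul_ne_zero hP hQ
  have hDq : Dq u v ≠ 0 := mul_ne_zero hP hW
  have hDp : Dp u v ≠ 0 := mul_ne_zero hQ hW
  simp only [Ds, Dq, Dp, Ns, Nq, Np, Rs, Rq, Rp, Es, poly5, Hf] at *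
  simp only [Pf, Qf, Wf] at *
  field_simp
  ring


/-! ### derivatives of the arcsin terms -/

/-- auxiliary identity `sqrt3P_pos` of the explicit B₄ evaluation. [folklore] -/
theorem sqrt3P_pos {u : ℝ} (hP : 0 < Pf u) : 0 < Real.sqrt (3 * Pf u) := Real.sqrt_pos.mpr (by linarith)
/-- auxiliary identity `sqrt3P_sq` of the explicit B₄ evaluation. [folklore] -/
theorem sqrt3P_sq {u : ℝ} (hP : 0 < Pf u) : Real.sqrt (3 * Pf u) ^ 2 = 3 * Pf u := Real.sq_sqrt (by linarith)

/-- derivative formula for `I0s` (B₄ evaluation, calculus layer). [folklore] -/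
theorem hasDerivAt_I0s {u v : ℝ} (hP : 0 < Pf u) (hH : 0 < Hf u v) :
    HasDerivAt (I0s u) (1 / Real.sqrt (Hf u v)) v := by
  have hρ := sqrt3P_pos hP
  have hρ2 := sqrt3P_sq hP
  have hsH : 0 < Real.sqrt (Hf u v) := Real.sqrt_pos.mpr hH
  have hsH2 : Real.sqrt (Hf u v) ^ 2 = Hf u v := Real.sq_sqrt hH.le
  have hf : HasDerivAt (fun x => (2 * x - u) / Real.sqrt (3 * Pf u)) (2 / Real.sqrt (3 * Pf u)) v := by
    have := (((hasDerivAt_id v).const_mul 2).sub_const u).div_const (Real.sqrt (3 * Pf u))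
    refine this.congr_deriv ?_; simp
  have hg : 0 < Real.sqrt (Hf u v) / Real.sqrt (3 * Pf u) := div_pos hsH hρ
  have hfg : 1 - ((2 * v - u) / Real.sqrt (3 * Pf u)) ^ 2 = (Real.sqrt (Hf u v) / Real.sqrt (3 * Pf u)) ^ 2 := by
    simp only [div_pow, hρ2, hsH2]
    field_simp
    simp only [Hf, Pf]; ring
  have := (hasDerivAt_arcsin_comp hf hg hfg).const_mul (1 / 2)
  have hfun : (fun x => 1 / 2 * arcsin ((2 * x - u) / Real.sqrt (3 * Pf u))) = I0s u := by
    funext x; simp [I0s]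
  rw [hfun] at this
  refine this.congr_deriv ?_
  field_simp

/-- derivative formula for `Jms` (B₄ evaluation, calculus layer). [folklore] -/
theorem hasDerivAt_Jms {u v : ℝ} (hP : 0 < Pf u) (hH : 0 < Hf u v) (hu : 0 < 2 * u + 1) (hv : 0 < v + 1) :
    HasDerivAt (Jms u) (1 / ((v + 1) * Real.sqrt (Hf u v))) v := by
  have hρ := sqrt3P_pos hP
  have hρ2 := sqrt3P_sq hP
  have hsH : 0 < Real.sqrt (Hf u v) := Real.sqrt_pos.mpr hH
  have hsH2 : Real.sqrt (Hf u v) ^ 2 = Hf u v := Real.sq_sqrt hH.le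
  have hf : HasDerivAt (fun x => ((2 * u + 1) ^ 2 / (x + 1) - 2 * (2 + u)) / (2 * Real.sqrt (3 * Pf u)))
      ((-((2 * u + 1) ^ 2) / (v + 1) ^ 2) / (2 * Real.sqrt (3 * Pf u))) v := by
    have h1 : HasDerivAt (fun x => (2 * u + 1) ^ 2 / (x + 1)) (-((2 * u + 1) ^ 2 * 1) / (v + 1) ^ 2) v := by
      have := ((hasDerivAt_id v).add_const 1)
      have := (hasDerivAt_const v ((2 * u + 1) ^ 2)).div this hv.ne'
      refine this.congr_deriv ?_; simp
    have := (h1.sub_const (2 * (2 + u))).div_const (2 * Real.sqrt (3 * Pf u))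
    refine this.congr_deriv ?_; ring
  have hg : 0 < (2 * u + 1) * Real.sqrt (Hf u v) / (2 * Real.sqrt (3 * Pf u) * (v + 1)) := by positivity
  have hfg : 1 - (((2 * u + 1) ^ 2 / (v + 1) - 2 * (2 + u)) / (2 * Real.sqrt (3 * Pf u))) ^ 2 =
      ((2 * u + 1) * Real.sqrt (Hf u v) / (2 * Real.sqrt (3 * Pf u) * (v + 1))) ^ 2 := by
    simp only [div_pow, mul_pow, hρ2, hsH2]
    field_simp
    simp only [Hf, Pf]; ring
  have := (hasDerivAt_arcsin_comp hf hg hfg).const_mul (-(1 / (2 * u + 1)))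
  have hfun : (fun x => -(1 / (2 * u + 1)) *
      arcsin (((2 * u + 1) ^ 2 / (x + 1) - 2 * (2 + u)) / (2 * Real.sqrt (3 * Pf u)))) = Jms u := by
    funext x; simp [Jms]
  rw [hfun] at this
  refine this.congr_deriv ?_
  field_simp

/-- derivative formula for `Jps` (B₄ evaluation, calculus layer). [folklore] -/
theorem hasDerivAt_Jps {u v : ℝ} (hP : 0 < Pf u) (hH : 0 < Hf u v) (hu : 0 < 2 * u + 1) (hv : 0 < 1 + u - v) :
    HasDerivAt (Jps u) (1 / ((1 + u - v) * Real.sqrt (Hf u v))) v := by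
  have hρ := sqrt3P_pos hP
  have hρ2 := sqrt3P_sq hP
  have hsH : 0 < Real.sqrt (Hf u v) := Real.sqrt_pos.mpr hH
  have hsH2 : Real.sqrt (Hf u v) ^ 2 = Hf u v := Real.sq_sqrt hH.le
  have hne : v - 1 - u ≠ 0 := by intro h; linarith
  have hf : HasDerivAt (fun x => ((2 * u + 1) ^ 2 / (x - 1 - u) + 2 * (2 + u)) / (2 * Real.sqrt (3 * Pf u)))
      ((-((2 * u + 1) ^ 2) / (v - 1 - u) ^ 2) / (2 * Real.sqrt (3 * Pf u))) v := by
    have h1 : HasDerivAt (fun x => (2 * u + 1) ^ 2 / (x - 1 - u)) (-((2 * u + 1) ^ 2 * 1) / (v - 1 - u) ^ 2) v := by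
      have := (((hasDerivAt_id v).sub_const 1).sub_const u)
      have := (hasDerivAt_const v ((2 * u + 1) ^ 2)).div this hne
      refine this.congr_deriv ?_; simp
    have := (h1.add_const (2 * (2 + u))).div_const (2 * Real.sqrt (3 * Pf u))
    refine this.congr_deriv ?_; ring
  have hg : 0 < (2 * u + 1) * Real.sqrt (Hf u v) / (2 * Real.sqrt (3 * Pf u) * (1 + u - v)) := by positivity
  have hfg : 1 - (((2 * u + 1) ^ 2 / (v - 1 - u) + 2 * (2 + u)) / (2 * Real.sqrt (3 * Pf u))) ^ 2 =
      ((2 * u + 1) * Real.sqrt (Hf u v) / (2 * Real.sqrt (3 * Pf u) * (1 + u - v))) ^ 2 := by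
    simp only [div_pow, mul_pow, hρ2, hsH2]
    field_simp
    simp only [Hf, Pf]; ring
  have := (hasDerivAt_arcsin_comp hf hg hfg).const_mul (-(1 / (2 * u + 1)))
  have hfun : (fun x => -(1 / (2 * u + 1)) *
      arcsin (((2 * u + 1) ^ 2 / (x - 1 - u) + 2 * (2 + u)) / (2 * Real.sqrt (3 * Pf u)))) = Jps u := by
    funext x; simp [Jps]
  rw [hfun] at this
  refine this.congr_deriv ?_
  field_simp
  ring


/-! ### assembling `F' = M` -/

set_option maxRecDepth 8000 in
/-- derivative formula for `Fs` (B₄ evaluation, calculus layer). [folklore] -/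
theorem hasDerivAt_Fs {u v : ℝ} (hP : 0 < Pf u) (hQ : 0 < Qf v) (hW : 0 < Wf u v) (hH : 0 < Hf u v)
    (hu : 0 < 2 * u + 1) (hv1 : 0 < v + 1) (hv2 : 0 < 1 + u - v) :
    HasDerivAt (Fs u) (Ms u v) v := by
  have hDs : 0 < Ds u v := mul_pos hP hQ
  have hDq : 0 < Dq u v := mul_pos hP hW
  have hDp : 0 < Dp u v := mul_pos hQ hW
  obtain ⟨s, hs⟩ : ∃ s, s = Real.sqrt (Hf u v) := ⟨_, rfl⟩
  have hs0 : 0 < s := by rw [hs]; exact Real.sqrt_pos.mpr hH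
  have hs2 : s ^ 2 = Hf u v := by rw [hs]; exact Real.sq_sqrt hH.le
  -- angle derivatives
  have hAs := hasDerivAt_arccos_quot (hasDerivAt_Ns u v) (hasDerivAt_Ds u v) hDs (by rw [Hf_eq_s]; exact hH)
  have hAq := hasDerivAt_arccos_quot (hasDerivAt_Nq u v) (hasDerivAt_Dq u v) hDq (by rw [Hf_eq_q]; exact hH)
  have hAp := hasDerivAt_arccos_quot (hasDerivAt_Np u v) (hasDerivAt_Dp u v) hDp (by rw [Hf_eq_p]; exact hH)
  rw [Hf_eq_s u v, ← hs] at hAs; rw [Hf_eq_q u v, ← hs] at hAq; rw [Hf_eq_p u v, ← hs] at hAp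
  -- polynomial pieces
  have hRs : HasDerivAt (Rs u) _ v := hasDerivAt_poly5 _ _ _ _ _ _ v
  have hRq : HasDerivAt (Rq u) _ v := hasDerivAt_poly5 _ _ _ _ _ _ v
  have hRp : HasDerivAt (Rp u) _ v := hasDerivAt_poly5 _ _ _ _ _ _ v
  have hEs : HasDerivAt (Es u) _ v := hasDerivAt_poly5 _ _ _ _ _ _ v
  have hsq : HasDerivAt (fun x => Real.sqrt (Hf u x)) ((-(8 * v) + 4 * u) / (2 * s)) v := by
    rw [hs]; exact (hasDerivAt_Hf u v).sqrt hH.ne'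
  have hI0 := hasDerivAt_I0s hP hH
  have hJm := hasDerivAt_Jms hP hH hu hv1
  have hJp := hasDerivAt_Jps hP hH hu hv2
  rw [← hs] at hI0 hJm hJp
  have hJm' := hJm.congr_deriv (show _ = 1 / (v + 1) * (1 / s) by field_simp)
  have hJp' := hJp.congr_deriv (show _ = 1 / (1 + u - v) * (1 / s) by field_simp)
  have hF := ((((hRs.mul hAs).add (hRq.mul hAq)).add (hRp.mul hAp)).const_mul π).add
    ((((hEs.mul hsq).add (hI0.const_mul (-(38/15 : ℝ) * Pf u))).add
      ((hJm'.add hJp').const_mul ((4/15 : ℝ) * Pf u * (2 * u + 1)))).const_mul (π / (2 * Pf u)))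
  have hF' : HasDerivAt (Fs u) _ v := hF.congr_of_eventuallyEq (Filter.Eventually.of_forall fun x => by
    simp only [Fs, As, Aq, Ap, Pi.add_apply, Pi.mul_apply])
  refine hF'.congr_deriv ?_
  have hk := key_identity u v hP.ne' hQ.ne' hW.ne' hv1.ne' hv2.ne'
  have d1 : (((-1) : ℝ) * u ^ 2 + (1 : ℝ)) + 2 * 0 * v + 3 * ((1/3 : ℝ) * u ^ 2 + ((-1)/3 : ℝ)) * v ^ 2 +
      4 * 0 * v ^ 3 + 5 * 0 * v ^ 4 = Ds u v := by
    simp only [Ds, Pf, Qf]; ring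
  have d2 : ((1 : ℝ) * u ^ 4 + ((-2) : ℝ) * u ^ 2 + (1 : ℝ)) + 2 * (((-1) : ℝ) * u ^ 3 + (1 : ℝ) * u) * v +
      3 * ((1/3 : ℝ) * u ^ 2 + ((-1)/3 : ℝ)) * v ^ 2 + 4 * 0 * v ^ 3 + 5 * 0 * v ^ 4 = Dq u v := by
    simp only [Dq, Pf, Wf]; ring
  have d3 : (((-1) : ℝ) * u ^ 2 + (1 : ℝ)) + 2 * ((1 : ℝ) * u) * v + 3 * ((1/3 : ℝ) * u ^ 2 + ((-2)/3 : ℝ)) * v ^ 2 +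
      4 * (((-1)/2 : ℝ) * u) * v ^ 3 + 5 * (1/5 : ℝ) * v ^ 4 = Dp u v := by
    simp only [Dp, Qf, Wf]; ring
  have e1 : ((((-7)/10 : ℝ) * u ^ 4 + (23/15 : ℝ) * u ^ 2 + ((-5)/6 : ℝ)) +
          2 * ((3/10 : ℝ) * u ^ 3 + ((-3)/10 : ℝ) * u) * v + 3 * (((-1)/5 : ℝ) * u ^ 2 + (1/5 : ℝ)) * v ^ 2 +
          4 * 0 * v ^ 3 + 5 * 0 * v ^ 4) * s =
      ((((-7)/10 : ℝ) * u ^ 4 + (23/15 : ℝ) * u ^ 2 + ((-5)/6 : ℝ)) +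
          2 * ((3/10 : ℝ) * u ^ 3 + ((-3)/10 : ℝ) * u) * v + 3 * (((-1)/5 : ℝ) * u ^ 2 + (1/5 : ℝ)) * v ^ 2 +
          4 * 0 * v ^ 3 + 5 * 0 * v ^ 4) * Hf u v / s := by
    rw [eq_div_iff hs0.ne', mul_assoc, ← sq, hs2]
  have e2 : π / 4 * (Pf u + Qf v + Wf u v) * s = π / 4 * (Pf u + Qf v + Wf u v) * Hf u v / s := by
    rw [eq_div_iff hs0.ne', mul_assoc, ← sq, hs2]
  simp only [Ms, As, Aq, Ap]
  rw [← hs, e1, e2]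
  linear_combination (π / s) * hk + (π * arccos (Ns u v / (2 * Real.sqrt (Ds u v)))) * d1 +
    (π * arccos (Nq u v / (2 * Real.sqrt (Dq u v)))) * d2 + (π * arccos (Np u v / (2 * Real.sqrt (Dp u v)))) * d3


end IS

namespace IOp


/-! ### opposite-side objects, parameter `a = 1 - u ∈ (0, 1/2)`, variable `v` -/

/-- auxiliary quantity `Pa` of the explicit B₄ evaluation (Lyberg's reduction, D = 3). [folklore] -/
def Pa (a : ℝ) : ℝ := a * (2 - a)
/-- auxiliary quantity `Qf` of the explicit B₄ evaluation (Lyberg's reduction, D = 3). [folklore] -/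
def Qf (v : ℝ) : ℝ := 1 - v ^ 2
/-- auxiliary quantity `Wo` of the explicit B₄ evaluation (Lyberg's reduction, D = 3). [folklore] -/
def Wo (a v : ℝ) : ℝ := 1 - (v - a) ^ 2
/-- auxiliary quantity `Ho` of the explicit B₄ evaluation (Lyberg's reduction, D = 3). [folklore] -/
def Ho (a v : ℝ) : ℝ := 8 * a * (1 - v) * (1 - a + v)
/-- auxiliary quantity `gso` of the explicit B₄ evaluation (Lyberg's reduction, D = 3). [folklore] -/
def gso (a v : ℝ) : ℝ := a * (1 - v) / ((2 - a) * (1 + v))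
/-- auxiliary quantity `gpo` of the explicit B₄ evaluation (Lyberg's reduction, D = 3). [folklore] -/
def gpo (a v : ℝ) : ℝ := (1 - a + v) * (1 - v) / ((1 + v) * (1 + a - v))
/-- auxiliary quantity `gqo` of the explicit B₄ evaluation (Lyberg's reduction, D = 3). [folklore] -/
def gqo (a v : ℝ) : ℝ := (1 - a + v) * a / ((2 - a) * (1 + a - v))
/-- auxiliary quantity `Aso` of the explicit B₄ evaluation (Lyberg's reduction, D = 3). [folklore] -/
def Aso (a v : ℝ) : ℝ := arccos (Real.sqrt (gso a v))
/-- auxiliary quantity `Apo` of the explicit B₄ evaluation (Lyberg's reduction, D = 3). [folklore] -/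
def Apo (a v : ℝ) : ℝ := arccos (Real.sqrt (gpo a v))
/-- auxiliary quantity `Aqo` of the explicit B₄ evaluation (Lyberg's reduction, D = 3). [folklore] -/
def Aqo (a v : ℝ) : ℝ := arccos (Real.sqrt (gqo a v))
/-- auxiliary quantity `Mo` of the explicit B₄ evaluation (Lyberg's reduction, D = 3). [folklore] -/
def Mo (a v : ℝ) : ℝ :=
  π * (Pa a * Qf v * Aso a v + Pa a * Wo a v * Aqo a v + Qf v * Wo a v * Apo a v) -
    π / 4 * (Pa a + Qf v + Wo a v) * Real.sqrt (Ho a v)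

/-- auxiliary quantity `Rso` of the explicit B₄ evaluation (Lyberg's reduction, D = 3). [folklore] -/
def Rso (a : ℝ) : ℝ → ℝ := poly5 ((2/3 : ℝ) * a ^ 2 + (4/3 : ℝ) * a + ((-16)/15 : ℝ)) (((-1) : ℝ) * a ^ 2 + (2 : ℝ) * a)
  0 ((1/3 : ℝ) * a ^ 2 + ((-2)/3 : ℝ) * a) 0 0
/-- auxiliary quantity `Rqo` of the explicit B₄ evaluation (Lyberg's reduction, D = 3). [folklore] -/
def Rqo (a : ℝ) : ℝ → ℝ := poly5 (((-3)/10 : ℝ) * a ^ 5 + (2/3 : ℝ) * a ^ 4 + (1/3 : ℝ) * a ^ 3 + ((-4)/3 : ℝ) * a ^ 2 + ((-4)/3 : ℝ) * a)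
  ((1 : ℝ) * a ^ 4 + ((-2) : ℝ) * a ^ 3 + ((-1) : ℝ) * a ^ 2 + (2 : ℝ) * a) (((-1) : ℝ) * a ^ 3 + (2 : ℝ) * a ^ 2)
  ((1/3 : ℝ) * a ^ 2 + ((-2)/3 : ℝ) * a) 0 0
/-- auxiliary quantity `Rpo` of the explicit B₄ evaluation (Lyberg's reduction, D = 3). [folklore] -/
def Rpo (a : ℝ) : ℝ → ℝ := poly5 ((2/3 : ℝ) * a ^ 2 + ((-1)/2 : ℝ) * a + ((-8)/15 : ℝ)) (((-1) : ℝ) * a ^ 2 + (1 : ℝ))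
  ((1 : ℝ) * a) ((1/3 : ℝ) * a ^ 2 + ((-2)/3 : ℝ)) (((-1)/2 : ℝ) * a) (1/5 : ℝ)
/-- auxiliary quantity `Eo` of the explicit B₄ evaluation (Lyberg's reduction, D = 3). [folklore] -/
def Eo (a : ℝ) : ℝ → ℝ := poly5 ((3/10 : ℝ) * a ^ 5 + ((-29)/30 : ℝ) * a ^ 4 + (1/2 : ℝ) * a ^ 3 + (7/15 : ℝ) * a ^ 2)
  (((-7)/10 : ℝ) * a ^ 4 + (32/15 : ℝ) * a ^ 3 + ((-1) : ℝ) * a ^ 2 + ((-14)/15 : ℝ) * a) ((3/10 : ℝ) * a ^ 3 + ((-3)/5 : ℝ) * a ^ 2)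
  (((-1)/5 : ℝ) * a ^ 2 + (2/5 : ℝ) * a) 0 0
/-- auxiliary quantity `kapo` of the explicit B₄ evaluation (Lyberg's reduction, D = 3). [folklore] -/
def kapo (a : ℝ) : ℝ := ((-16)/15 : ℝ) * a ^ 5 + (64/5 : ℝ) * a ^ 4 + ((-64)/3 : ℝ) * a ^ 3
/-- auxiliary quantity `I0o` of the explicit B₄ evaluation (Lyberg's reduction, D = 3). [folklore] -/
def I0o (a v : ℝ) : ℝ := 1 / (2 * Real.sqrt (2 * a)) * arcsin ((2 * v - a) / (2 - a))
/-- auxiliary quantity `Fo` of the explicit B₄ evaluation (Lyberg's reduction, D = 3). [folklore] -/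
def Fo (a v : ℝ) : ℝ :=
  π * (Rso a v * Aso a v + Rqo a v * Aqo a v + Rpo a v * Apo a v) +
    π / (2 * Pa a) * (Eo a v * Real.sqrt (Ho a v) + kapo a * I0o a v)

/-! ### derivatives -/
/-- derivative formula for `Qf` (B₄ evaluation, calculus layer). [folklore] -/
theorem hasDerivAt_Qf (v : ℝ) : HasDerivAt Qf (-(2 * v)) v := by
  have h := ((hasDerivAt_pow 2 v).const_sub 1)
  have hq : Qf = fun x => 1 - x ^ 2 := rfl
  rw [hq]; refine h.congr_deriv ?_; simp
/-- derivative formula for `Wo` (B₄ evaluation, calculus layer). [folklore] -/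
theorem hasDerivAt_Wo (a v : ℝ) : HasDerivAt (Wo a) (-(2 * (v - a))) v := by
  have h := (((hasDerivAt_id v).sub_const a).pow 2).const_sub 1
  refine (h.congr_deriv ?_).congr_of_eventuallyEq ?_
  · simp
  · exact Filter.Eventually.of_forall fun x => by simp [Wo]
/-- derivative formula for `Ho` (B₄ evaluation, calculus layer). [folklore] -/
theorem hasDerivAt_Ho (a v : ℝ) : HasDerivAt (Ho a) ((8 : ℝ) * a ^ 2 + ((-16) : ℝ) * a * v) v := by
  have h := (((hasDerivAt_id v).const_sub 1).const_mul (8 * a)).mul (((hasDerivAt_id v).const_add (1 - a)))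
  refine (h.congr_deriv ?_).congr_of_eventuallyEq ?_
  · simp only [id_eq]; ring
  · exact Filter.Eventually.of_forall fun x => by simp [Ho]

/-- derivative formula for `gso` (B₄ evaluation, calculus layer). [folklore] -/
theorem hasDerivAt_gso (a v : ℝ) (hv : 0 < 1 + v) (ha : 0 < 2 - a) :
    HasDerivAt (gso a) (-(2 * a) / ((2 - a) * (1 + v) ^ 2)) v := by
  have h1 : HasDerivAt (fun x => a * (1 - x)) (a * (-1)) v := ((hasDerivAt_id v).const_sub 1).const_mul a |>.congr_deriv (by simp)
  have h2 : HasDerivAt (fun x => (2 - a) * (1 + x)) ((2 - a) * 1) v := ((hasDerivAt_id v).const_add 1).const_mul (2 - a) |>.congr_deriv (by simp)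
  have h := h1.div h2 (by positivity)
  refine (h.congr_deriv ?_).congr_of_eventuallyEq (Filter.Eventually.of_forall fun x => by simp [gso])
  field_simp; ring

/-- derivative formula for `gpo` (B₄ evaluation, calculus layer). [folklore] -/
theorem hasDerivAt_gpo (a v : ℝ) (hv : 0 < 1 + v) (hw : 0 < 1 + a - v) :
    HasDerivAt (gpo a) (((a - 2 * v) * (1 + v) * (1 + a - v) - (1 - a + v) * (1 - v) * (a - 2 * v)) /
      ((1 + v) * (1 + a - v)) ^ 2) v := by
  have h1 : HasDerivAt (fun x => (1 - a + x) * (1 - x)) (1 * (1 - v) + (1 - a + v) * (-1)) v :=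
    ((hasDerivAt_id v).const_add (1 - a)).mul ((hasDerivAt_id v).const_sub 1) |>.congr_deriv (by simp)
  have h2 : HasDerivAt (fun x => (1 + x) * (1 + a - x)) (1 * (1 + a - v) + (1 + v) * (-1)) v :=
    ((hasDerivAt_id v).const_add 1).mul ((hasDerivAt_id v).const_sub (1 + a)) |>.congr_deriv (by simp)
  have h := h1.div h2 (by positivity)
  refine (h.congr_deriv ?_).congr_of_eventuallyEq (Filter.Eventually.of_forall fun x => by simp [gpo])
  field_simp; ring

/-- derivative formula for `gqo` (B₄ evaluation, calculus layer). [folklore] -/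
theorem hasDerivAt_gqo (a v : ℝ) (ha : 0 < 2 - a) (hw : 0 < 1 + a - v) :
    HasDerivAt (gqo a) ((a * ((2 - a) * (1 + a - v)) - (1 - a + v) * a * (-(2 - a))) /
      ((2 - a) * (1 + a - v)) ^ 2) v := by
  have h1 : HasDerivAt (fun x => (1 - a + x) * a) (1 * a) v :=
    ((hasDerivAt_id v).const_add (1 - a)).mul_const a |>.congr_deriv (by simp)
  have h2 : HasDerivAt (fun x => (2 - a) * (1 + a - x)) ((2 - a) * (-1)) v :=
    ((hasDerivAt_id v).const_sub (1 + a)).const_mul (2 - a) |>.congr_deriv (by simp)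
  have h := h1.div h2 (by positivity)
  refine (h.congr_deriv ?_).congr_of_eventuallyEq (Filter.Eventually.of_forall fun x => by simp [gqo])
  field_simp


/-! ### angle derivatives -/
/-- auxiliary identity `gso_mul` of the explicit B₄ evaluation. [folklore] -/
theorem gso_mul (a v : ℝ) (ha : 2 - a ≠ 0) (hv : 1 + v ≠ 0) :
    gso a v * (1 - gso a v) = Ho a v / (2 * (2 - a) * (1 + v)) ^ 2 := by
  simp only [gso, Ho]; field_simp; ring
/-- auxiliary identity `gpo_mul` of the explicit B₄ evaluation. [folklore] -/
theorem gpo_mul (a v : ℝ) (hv : 1 + v ≠ 0) (hw : 1 + a - v ≠ 0) :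
    gpo a v * (1 - gpo a v) = Ho a v / (2 * (1 + v) * (1 + a - v)) ^ 2 := by
  simp only [gpo, Ho]; field_simp; ring
/-- auxiliary identity `gqo_mul` of the explicit B₄ evaluation. [folklore] -/
theorem gqo_mul (a v : ℝ) (ha : 2 - a ≠ 0) (hw : 1 + a - v ≠ 0) :
    gqo a v * (1 - gqo a v) = Ho a v / (2 * (2 - a) * (1 + a - v)) ^ 2 := by
  simp only [gqo, Ho]; field_simp; ring

/-- derivative formula for `Aso` (B₄ evaluation, calculus layer). [folklore] -/
theorem hasDerivAt_Aso {a v : ℝ} (ha0 : 0 < a) (ha : 0 < 2 - a) (hv : 0 < 1 + v) (hv1 : 0 < 1 - v)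
    (hH : 0 < Ho a v) :
    HasDerivAt (Aso a) (2 * a / (1 + v) * (1 / Real.sqrt (Ho a v))) v := by
  have hs : 0 < Real.sqrt (Ho a v) := Real.sqrt_pos.mpr hH
  have hs2 : Real.sqrt (Ho a v) ^ 2 = Ho a v := Real.sq_sqrt hH.le
  have hg : 0 < gso a v := by simp only [gso]; positivity
  have hk : 0 < Real.sqrt (Ho a v) / (2 * (2 - a) * (1 + v)) := by positivity
  have hgk : gso a v * (1 - gso a v) = (Real.sqrt (Ho a v) / (2 * (2 - a) * (1 + v))) ^ 2 := by
    rw [div_pow, hs2]; exact gso_mul a v ha.ne' hv.ne'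
  have h := hasDerivAt_arccos_sqrt (hasDerivAt_gso a v hv ha) hg hk hgk
  refine (h.congr_deriv ?_).congr_of_eventuallyEq (Filter.Eventually.of_forall fun x => by simp [Aso])
  field_simp

/-- derivative formula for `Apo` (B₄ evaluation, calculus layer). [folklore] -/
theorem hasDerivAt_Apo {a v : ℝ} (hv : 0 < 1 + v) (hv1 : 0 < 1 - v) (hw : 0 < 1 - a + v)
    (hw2 : 0 < 1 + a - v) (hH : 0 < Ho a v) :
    HasDerivAt (Apo a) (2 * a * (2 * v - a) / ((1 + v) * (1 + a - v)) * (1 / Real.sqrt (Ho a v))) v := by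
  have hs : 0 < Real.sqrt (Ho a v) := Real.sqrt_pos.mpr hH
  have hs2 : Real.sqrt (Ho a v) ^ 2 = Ho a v := Real.sq_sqrt hH.le
  have hg : 0 < gpo a v := by simp only [gpo]; positivity
  have hk : 0 < Real.sqrt (Ho a v) / (2 * (1 + v) * (1 + a - v)) := by positivity
  have hgk : gpo a v * (1 - gpo a v) = (Real.sqrt (Ho a v) / (2 * (1 + v) * (1 + a - v))) ^ 2 := by
    rw [div_pow, hs2]; exact gpo_mul a v hv.ne' hw2.ne'
  have h := hasDerivAt_arccos_sqrt (hasDerivAt_gpo a v hv hw2) hg hk hgk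
  refine (h.congr_deriv ?_).congr_of_eventuallyEq (Filter.Eventually.of_forall fun x => by simp [Apo])
  field_simp
  ring

/-- derivative formula for `Aqo` (B₄ evaluation, calculus layer). [folklore] -/
theorem hasDerivAt_Aqo {a v : ℝ} (ha0 : 0 < a) (ha : 0 < 2 - a) (hw : 0 < 1 - a + v)
    (hw2 : 0 < 1 + a - v) (hH : 0 < Ho a v) :
    HasDerivAt (Aqo a) (-(2 * a) / (1 + a - v) * (1 / Real.sqrt (Ho a v))) v := by
  have hs : 0 < Real.sqrt (Ho a v) := Real.sqrt_pos.mpr hH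
  have hs2 : Real.sqrt (Ho a v) ^ 2 = Ho a v := Real.sq_sqrt hH.le
  have hg : 0 < gqo a v := by simp only [gqo]; positivity
  have hk : 0 < Real.sqrt (Ho a v) / (2 * (2 - a) * (1 + a - v)) := by positivity
  have hgk : gqo a v * (1 - gqo a v) = (Real.sqrt (Ho a v) / (2 * (2 - a) * (1 + a - v))) ^ 2 := by
    rw [div_pow, hs2]; exact gqo_mul a v ha.ne' hw2.ne'
  have h := hasDerivAt_arccos_sqrt (hasDerivAt_gqo a v ha hw2) hg hk hgk
  refine (h.congr_deriv ?_).congr_of_eventuallyEq (Filter.Eventually.of_forall fun x => by simp [Aqo])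
  field_simp
  ring

/-- derivative formula for `I0o` (B₄ evaluation, calculus layer). [folklore] -/
theorem hasDerivAt_I0o {a v : ℝ} (ha0 : 0 < a) (ha : 0 < 2 - a) (hH : 0 < Ho a v) :
    HasDerivAt (I0o a) (1 / Real.sqrt (Ho a v)) v := by
  have hs : 0 < Real.sqrt (Ho a v) := Real.sqrt_pos.mpr hH
  have hs2 : Real.sqrt (Ho a v) ^ 2 = Ho a v := Real.sq_sqrt hH.le
  have hr : 0 < Real.sqrt (2 * a) := Real.sqrt_pos.mpr (by linarith)
  have hr2 : Real.sqrt (2 * a) ^ 2 = 2 * a := Real.sq_sqrt (by linarith)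
  have hf : HasDerivAt (fun x => (2 * x - a) / (2 - a)) (2 / (2 - a)) v := by
    have := (((hasDerivAt_id v).const_mul 2).sub_const a).div_const (2 - a)
    refine this.congr_deriv ?_; simp
  have hg : 0 < Real.sqrt (Ho a v) / (Real.sqrt (2 * a) * (2 - a)) := by positivity
  have hfg : 1 - ((2 * v - a) / (2 - a)) ^ 2 = (Real.sqrt (Ho a v) / (Real.sqrt (2 * a) * (2 - a))) ^ 2 := by
    simp only [div_pow, mul_pow, hs2, hr2]
    field_simp
    simp only [Ho]; ring
  have := (hasDerivAt_arcsin_comp hf hg hfg).const_mul (1 / (2 * Real.sqrt (2 * a)))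
  refine (this.congr_deriv ?_).congr_of_eventuallyEq (Filter.Eventually.of_forall fun x => by simp [I0o])
  field_simp

/-! ### key identity and assembly -/
/-- auxiliary identity `key_identity_opp` of the explicit B₄ evaluation. [folklore] -/
theorem key_identity_opp (a v : ℝ) (ha : a ≠ 0) (ha2 : 2 - a ≠ 0) (hv : 1 + v ≠ 0) (hw : 1 + a - v ≠ 0) :
    Rso a v * (2 * a / (1 + v)) + Rqo a v * (-(2 * a) / (1 + a - v)) +
        Rpo a v * (2 * a * (2 * v - a) / ((1 + v) * (1 + a - v))) +
      1 / (2 * Pa a) * (((((-7)/10 : ℝ) * a ^ 4 + (32/15 : ℝ) * a ^ 3 + ((-1) : ℝ) * a ^ 2 + ((-14)/15 : ℝ) * a) +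
          2 * ((3/10 : ℝ) * a ^ 3 + ((-3)/5 : ℝ) * a ^ 2) * v + 3 * (((-1)/5 : ℝ) * a ^ 2 + (2/5 : ℝ) * a) * v ^ 2 +
          4 * 0 * v ^ 3 + 5 * 0 * v ^ 4) * Ho a v +
        Eo a v * ((8 : ℝ) * a ^ 2 + ((-16) : ℝ) * a * v) / 2 + kapo a)
      = -(1 / 4) * (Pa a + Qf v + Wo a v) * Ho a v := by
  simp only [Rso, Rqo, Rpo, Eo, kapo, poly5, Ho, Pa, Qf, Wo] at *
  field_simp
  ring

set_option maxRecDepth 8000 in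
/-- derivative formula for `Fo` (B₄ evaluation, calculus layer). [folklore] -/
theorem hasDerivAt_Fo {a v : ℝ} (ha0 : 0 < a) (ha1 : a < 1) (hv0 : 0 < 1 + v) (hv1 : v < 1) (hw : 0 < 1 - a + v) :
    HasDerivAt (Fo a) (Mo a v) v := by
  have ha : 0 < 2 - a := by linarith
  have hw2 : 0 < 1 + a - v := by linarith
  have hv1' : 0 < 1 - v := by linarith
  have hP : 0 < Pa a := by simp only [Pa]; positivity
  have hH : 0 < Ho a v := by simp only [Ho]; positivity
  obtain ⟨s, hs⟩ : ∃ s, s = Real.sqrt (Ho a v) := ⟨_, rfl⟩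
  have hs0 : 0 < s := by rw [hs]; exact Real.sqrt_pos.mpr hH
  have hs2 : s ^ 2 = Ho a v := by rw [hs]; exact Real.sq_sqrt hH.le
  have hAs := hasDerivAt_Aso ha0 ha hv0 hv1' hH
  have hAp := hasDerivAt_Apo hv0 hv1' hw hw2 hH
  have hAq := hasDerivAt_Aqo ha0 ha hw hw2 hH
  rw [← hs] at hAs hAp hAq
  have hRs : HasDerivAt (Rso a) _ v := hasDerivAt_poly5 _ _ _ _ _ _ v
  have hRq : HasDerivAt (Rqo a) _ v := hasDerivAt_poly5 _ _ _ _ _ _ v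
  have hRp : HasDerivAt (Rpo a) _ v := hasDerivAt_poly5 _ _ _ _ _ _ v
  have hEo : HasDerivAt (Eo a) _ v := hasDerivAt_poly5 _ _ _ _ _ _ v
  have hsq : HasDerivAt (fun x => Real.sqrt (Ho a x)) (((8 : ℝ) * a ^ 2 + ((-16) : ℝ) * a * v) / (2 * s)) v := by
    rw [hs]; exact (hasDerivAt_Ho a v).sqrt hH.ne'
  have hI0 := hasDerivAt_I0o ha0 ha hH
  rw [← hs] at hI0
  have hF := ((((hRs.mul hAs).add (hRq.mul hAq)).add (hRp.mul hAp)).const_mul π).add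
    (((hEo.mul hsq).add (hI0.const_mul (kapo a))).const_mul (π / (2 * Pa a)))
  have hF' : HasDerivAt (Fo a) _ v := hF.congr_of_eventuallyEq (Filter.Eventually.of_forall fun x => by
    simp only [Fo, Pi.add_apply, Pi.mul_apply])
  refine hF'.congr_deriv ?_
  have hk := key_identity_opp a v ha0.ne' ha.ne' hv0.ne' hw2.ne'
  have d1 : (((-1) : ℝ) * a ^ 2 + (2 : ℝ) * a) + 2 * 0 * v + 3 * ((1/3 : ℝ) * a ^ 2 + ((-2)/3 : ℝ) * a) * v ^ 2 +
      4 * 0 * v ^ 3 + 5 * 0 * v ^ 4 = Pa a * Qf v := by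
    simp only [Pa, Qf]; ring
  have d2 : ((1 : ℝ) * a ^ 4 + ((-2) : ℝ) * a ^ 3 + ((-1) : ℝ) * a ^ 2 + (2 : ℝ) * a) +
      2 * (((-1) : ℝ) * a ^ 3 + (2 : ℝ) * a ^ 2) * v + 3 * ((1/3 : ℝ) * a ^ 2 + ((-2)/3 : ℝ) * a) * v ^ 2 +
      4 * 0 * v ^ 3 + 5 * 0 * v ^ 4 = Pa a * Wo a v := by
    simp only [Pa, Wo]; ring
  have d3 : (((-1) : ℝ) * a ^ 2 + (1 : ℝ)) + 2 * ((1 : ℝ) * a) * v + 3 * ((1/3 : ℝ) * a ^ 2 + ((-2)/3 : ℝ)) * v ^ 2 +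
      4 * (((-1)/2 : ℝ) * a) * v ^ 3 + 5 * (1/5 : ℝ) * v ^ 4 = Qf v * Wo a v := by
    simp only [Qf, Wo]; ring
  have e1 : ((((-7)/10 : ℝ) * a ^ 4 + (32/15 : ℝ) * a ^ 3 + ((-1) : ℝ) * a ^ 2 + ((-14)/15 : ℝ) * a) +
          2 * ((3/10 : ℝ) * a ^ 3 + ((-3)/5 : ℝ) * a ^ 2) * v + 3 * (((-1)/5 : ℝ) * a ^ 2 + (2/5 : ℝ) * a) * v ^ 2 +
          4 * 0 * v ^ 3 + 5 * 0 * v ^ 4) * s =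
      ((((-7)/10 : ℝ) * a ^ 4 + (32/15 : ℝ) * a ^ 3 + ((-1) : ℝ) * a ^ 2 + ((-14)/15 : ℝ) * a) +
          2 * ((3/10 : ℝ) * a ^ 3 + ((-3)/5 : ℝ) * a ^ 2) * v + 3 * (((-1)/5 : ℝ) * a ^ 2 + (2/5 : ℝ) * a) * v ^ 2 +
          4 * 0 * v ^ 3 + 5 * 0 * v ^ 4) * Ho a v / s := by
    rw [eq_div_iff hs0.ne', mul_assoc, ← sq, hs2]
  have e2 : π / 4 * (Pa a + Qf v + Wo a v) * s = π / 4 * (Pa a + Qf v + Wo a v) * Ho a v / s := by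
    rw [eq_div_iff hs0.ne', mul_assoc, ← sq, hs2]
  simp only [Mo]
  rw [← hs, e1, e2]
  linear_combination (π / s) * hk + (π * Aso a v) * d1 + (π * Aqo a v) * d2 + (π * Apo a v) * d3


end IOp

namespace OUT


/-! ### the outer objects -/
/-- auxiliary quantity `Hq` of the explicit B₄ evaluation (Lyberg's reduction, D = 3). [folklore] -/
def Hq (u : ℝ) : ℝ := 2 * (1 - u) * (1 + 2 * u)
/-- auxiliary quantity `gS` of the explicit B₄ evaluation (Lyberg's reduction, D = 3). [folklore] -/
def gS (u : ℝ) : ℝ := (1 - u) / (3 * (1 + u))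
/-- auxiliary quantity `gP` of the explicit B₄ evaluation (Lyberg's reduction, D = 3). [folklore] -/
def gP (u : ℝ) : ℝ := (1 + 2 * u) / (3 * (3 - 2 * u))
/-- auxiliary quantity `gQ` of the explicit B₄ evaluation (Lyberg's reduction, D = 3). [folklore] -/
def gQ (u : ℝ) : ℝ := (1 - u) * (1 + 2 * u) / ((1 + u) * (3 - 2 * u))
/-- auxiliary quantity `ThS` of the explicit B₄ evaluation (Lyberg's reduction, D = 3). [folklore] -/
def ThS (u : ℝ) : ℝ := arccos (Real.sqrt (gS u))
/-- auxiliary quantity `ThP` of the explicit B₄ evaluation (Lyberg's reduction, D = 3). [folklore] -/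
def ThP (u : ℝ) : ℝ := arccos (Real.sqrt (gP u))
/-- auxiliary quantity `ThQ` of the explicit B₄ evaluation (Lyberg's reduction, D = 3). [folklore] -/
def ThQ (u : ℝ) : ℝ := arccos (Real.sqrt (gQ u))
/-- auxiliary quantity `I0q` of the explicit B₄ evaluation (Lyberg's reduction, D = 3). [folklore] -/
def I0q (u : ℝ) : ℝ := 1 / 2 * arcsin ((4 * u - 1) / 3)
/-- auxiliary quantity `Jm` of the explicit B₄ evaluation (Lyberg's reduction, D = 3). [folklore] -/
def Jm (u : ℝ) : ℝ := -(1 / 2) * arcsin ((4 / (1 + u) - 5) / 3)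
/-- auxiliary quantity `Om` of the explicit B₄ evaluation (Lyberg's reduction, D = 3). [folklore] -/
def Om (u : ℝ) : ℝ := arccos (u / (1 + u))
/-- auxiliary quantity `Uf` of the explicit B₄ evaluation (Lyberg's reduction, D = 3). [folklore] -/
def Uf (u : ℝ) : ℝ := (1 - u) ^ 2 * Real.sqrt (1 - u) * (4 - (2/7 : ℝ) * (1 - u))
/-- `rXi = fXi²`, `fXi` the (negative) argument of `Jms u (1/2)` [folklore] -/
def rXi (u : ℝ) : ℝ := (1 - u) * (4 * u + 5) ^ 2 / (27 * (1 + u))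
/-- `asf u = arcsin √rXi = - arcsin (fXi u)` [folklore] -/
def asf (u : ℝ) : ℝ := arcsin (Real.sqrt (rXi u))

/-- auxiliary quantity `SsP` of the explicit B₄ evaluation (Lyberg's reduction, D = 3). [folklore] -/
def SsP (u : ℝ) : ℝ := (5/36 : ℝ) * u ^ 3 + ((-4)/3 : ℝ) * u ^ 2 + (39/20 : ℝ) * u + (181/30 : ℝ)
/-- auxiliary quantity `SpP` of the explicit B₄ evaluation (Lyberg's reduction, D = 3). [folklore] -/
def SpP (u : ℝ) : ℝ := (5/36 : ℝ) * u ^ 3 + ((-5)/24 : ℝ) * u ^ 2 + ((-47)/160 : ℝ) * u + ((-189)/320 : ℝ)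
/-- auxiliary quantity `SqP` of the explicit B₄ evaluation (Lyberg's reduction, D = 3). [folklore] -/
def SqP (u : ℝ) : ℝ := (1/30 : ℝ) * u ^ 5 + ((-1)/12 : ℝ) * u ^ 4 + ((-1)/9 : ℝ) * u ^ 3 + (11/12 : ℝ) * u ^ 2 + ((-17)/10 : ℝ) * u
/-- auxiliary quantity `EqP` of the explicit B₄ evaluation (Lyberg's reduction, D = 3). [folklore] -/
def EqP (u : ℝ) : ℝ := ((-1)/60 : ℝ) * u ^ 3 + ((-1)/210 : ℝ) * u ^ 2 + (23/168 : ℝ) * u + ((-73)/3360 : ℝ)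
/-- auxiliary quantity `csInt` of the explicit B₄ evaluation (Lyberg's reduction, D = 3). [folklore] -/
def csInt (u : ℝ) : ℝ := ((-4)/3 : ℝ) * u ^ 2 + (8/5 : ℝ) * u
/-- auxiliary quantity `rhoS` of the explicit B₄ evaluation (Lyberg's reduction, D = 3). [folklore] -/
def rhoS (u : ℝ) : ℝ := (5/12 : ℝ) * u ^ 2 + ((-8)/3 : ℝ) * u + (39/20 : ℝ)
/-- auxiliary quantity `rhoQ` of the explicit B₄ evaluation (Lyberg's reduction, D = 3). [folklore] -/
def rhoQ (u : ℝ) : ℝ := (1/6 : ℝ) * u ^ 4 + ((-1)/3 : ℝ) * u ^ 3 + ((-1)/3 : ℝ) * u ^ 2 + (11/6 : ℝ) * u + ((-17)/10 : ℝ)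
/-- auxiliary quantity `rhoP` of the explicit B₄ evaluation (Lyberg's reduction, D = 3). [folklore] -/
def rhoP (u : ℝ) : ℝ := (5/12 : ℝ) * u ^ 2 + ((-5)/12 : ℝ) * u + ((-47)/160 : ℝ)
/-- auxiliary quantity `Etot` of the explicit B₄ evaluation (Lyberg's reduction, D = 3). [folklore] -/
def Etot (u : ℝ) : ℝ := ((-1)/6 : ℝ) * u ^ 4 + ((-1)/60 : ℝ) * u ^ 3 + (67/120 : ℝ) * u ^ 2 + (1/60 : ℝ) * u + ((-47)/120 : ℝ)
/-- auxiliary quantity `csO` of the explicit B₄ evaluation (Lyberg's reduction, D = 3). [folklore] -/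
def csO (u : ℝ) : ℝ := ((-8)/3 : ℝ) * u + (8/5 : ℝ)

/-- the outer antiderivative [folklore] -/
def G (u : ℝ) : ℝ :=
  π ^ 2 * u / 5 + π ^ 2 / 2 * csInt u - π * (SsP u * ThS u + SpP u * ThP u + SqP u * ThQ u) +
    -(2 * π / 15) * (u - 1) * asf u + 2 * Real.sqrt 2 / 15 * π * Uf u * Om u +
    π * (EqP u * Real.sqrt (Hq u) + (9/14 : ℝ) * I0q u + (148/21 : ℝ) * Jm u)

/-- the outer integrand (closed form of the inner integrals) [folklore] -/
def Iu (u : ℝ) : ℝ :=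
  π ^ 2 / 5 + π ^ 2 / 2 * csO u - π * (rhoS u * ThS u + rhoQ u * ThQ u + rhoP u * ThP u) -
    π / (2 * (1 - u ^ 2)) * Etot u * Real.sqrt (Hq u) - 2 * π / 15 * asf u +
    2 * Real.sqrt 2 / 15 * π * ((1 - u) * Real.sqrt (1 - u) * (1 - u - 10)) * Om u

/-! ### derivatives of polynomial pieces (via `deriv`-free explicit constructions) -/
/-- derivative formula for `cubic` (B₄ evaluation, calculus layer). [folklore] -/
theorem hasDerivAt_cubic (c0 c1 c2 c3 u : ℝ) :
    HasDerivAt (fun x => c3 * x ^ 3 + c2 * x ^ 2 + c1 * x + c0) (3 * c3 * u ^ 2 + 2 * c2 * u + c1) u := by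
  have h := ((((hasDerivAt_pow 3 u).const_mul c3).add ((hasDerivAt_pow 2 u).const_mul c2)).add
    ((hasDerivAt_id u).const_mul c1)).add_const c0
  refine (h.congr_deriv ?_).congr_of_eventuallyEq (Filter.Eventually.of_forall fun x => by simp)
  push_cast; ring

/-- derivative formula for `quintic` (B₄ evaluation, calculus layer). [folklore] -/
theorem hasDerivAt_quintic (c0 c1 c2 c3 c4 c5 u : ℝ) :
    HasDerivAt (fun x => c5 * x ^ 5 + c4 * x ^ 4 + c3 * x ^ 3 + c2 * x ^ 2 + c1 * x + c0)
      (5 * c5 * u ^ 4 + 4 * c4 * u ^ 3 + 3 * c3 * u ^ 2 + 2 * c2 * u + c1) u := by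
  have h := ((((((hasDerivAt_pow 5 u).const_mul c5).add ((hasDerivAt_pow 4 u).const_mul c4)).add
    ((hasDerivAt_pow 3 u).const_mul c3)).add ((hasDerivAt_pow 2 u).const_mul c2)).add
    ((hasDerivAt_id u).const_mul c1)).add_const c0
  refine (h.congr_deriv ?_).congr_of_eventuallyEq (Filter.Eventually.of_forall fun x => by simp)
  push_cast; ring

/-- derivative formula for `SsP` (B₄ evaluation, calculus layer). [folklore] -/
theorem hasDerivAt_SsP (u : ℝ) : HasDerivAt SsP (rhoS u) u := by
  have h := hasDerivAt_cubic (181/30 : ℝ) (39/20 : ℝ) ((-4)/3 : ℝ) (5/36 : ℝ) u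
  refine (h.congr_deriv ?_).congr_of_eventuallyEq (Filter.Eventually.of_forall fun x => by simp [SsP])
  simp only [rhoS]; ring
/-- derivative formula for `SpP` (B₄ evaluation, calculus layer). [folklore] -/
theorem hasDerivAt_SpP (u : ℝ) : HasDerivAt SpP (rhoP u) u := by
  have h := hasDerivAt_cubic ((-189)/320 : ℝ) ((-47)/160 : ℝ) ((-5)/24 : ℝ) (5/36 : ℝ) u
  refine (h.congr_deriv ?_).congr_of_eventuallyEq (Filter.Eventually.of_forall fun x => by simp [SpP])
  simp only [rhoP]; ring
/-- derivative formula for `SqP` (B₄ evaluation, calculus layer). [folklore] -/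
theorem hasDerivAt_SqP (u : ℝ) : HasDerivAt SqP (rhoQ u) u := by
  have h := hasDerivAt_quintic 0 ((-17)/10 : ℝ) (11/12 : ℝ) ((-1)/9 : ℝ) ((-1)/12 : ℝ) (1/30 : ℝ) u
  refine (h.congr_deriv ?_).congr_of_eventuallyEq (Filter.Eventually.of_forall fun x => by simp [SqP])
  simp only [rhoQ]; ring
/-- derivative formula for `EqP` (B₄ evaluation, calculus layer). [folklore] -/
theorem hasDerivAt_EqP (u : ℝ) :
    HasDerivAt EqP (((-1)/20 : ℝ) * u ^ 2 + ((-1)/105 : ℝ) * u + (23/168 : ℝ)) u := by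
  have h := hasDerivAt_cubic ((-73)/3360 : ℝ) (23/168 : ℝ) ((-1)/210 : ℝ) ((-1)/60 : ℝ) u
  refine (h.congr_deriv ?_).congr_of_eventuallyEq (Filter.Eventually.of_forall fun x => by simp [EqP])
  ring
/-- derivative formula for `csInt` (B₄ evaluation, calculus layer). [folklore] -/
theorem hasDerivAt_csInt (u : ℝ) : HasDerivAt csInt (csO u) u := by
  have h := hasDerivAt_cubic 0 (8/5 : ℝ) ((-4)/3 : ℝ) 0 u
  refine (h.congr_deriv ?_).congr_of_eventuallyEq (Filter.Eventually.of_forall fun x => by simp [csInt])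
  simp only [csO]; ring
/-- derivative formula for `Hq` (B₄ evaluation, calculus layer). [folklore] -/
theorem hasDerivAt_Hq (u : ℝ) : HasDerivAt Hq (2 - 8 * u) u := by
  have h := hasDerivAt_cubic 2 2 (-4) 0 u
  refine (h.congr_deriv ?_).congr_of_eventuallyEq (Filter.Eventually.of_forall fun x => by simp [Hq]; ring)
  ring


/-! ### transcendental derivatives in `u` -/
section
variable {u : ℝ} (hu0 : 1 / 2 < u) (hu1 : u < 1)
include hu0 hu1

/-- auxiliary identity `Hq_pos'` of the explicit B₄ evaluation. [folklore] -/
theorem Hq_pos' : 0 < Hq u := by simp only [Hq]; nlinarith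
/-- auxiliary identity `sHq_pos` of the explicit B₄ evaluation. [folklore] -/
theorem sHq_pos : 0 < Real.sqrt (Hq u) := Real.sqrt_pos.mpr (Hq_pos' hu0 hu1)
/-- auxiliary identity `sHq_sq` of the explicit B₄ evaluation. [folklore] -/
theorem sHq_sq : Real.sqrt (Hq u) ^ 2 = Hq u := Real.sq_sqrt (Hq_pos' hu0 hu1).le

/-- derivative formula for `ThS` (B₄ evaluation, calculus layer). [folklore] -/
theorem hasDerivAt_ThS : HasDerivAt ThS (1 / (1 + u) * (1 / Real.sqrt (Hq u))) u := by
  have hs := sHq_pos hu0 hu1; have hs2 := sHq_sq hu0 hu1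
  have hg : HasDerivAt gS (((-1) * (3 * (1 + u)) - (1 - u) * (3 * 1)) / (3 * (1 + u)) ^ 2) u := by
    have h := ((hasDerivAt_id u).const_sub 1).div (((hasDerivAt_id u).const_add 1).const_mul 3) (by positivity)
    exact h.congr_of_eventuallyEq (Filter.Eventually.of_forall fun x => by simp [gS])
  have hpos : 0 < gS u := by simp only [gS]; apply div_pos <;> linarith
  have hk : 0 < Real.sqrt (Hq u) / (3 * (1 + u)) := by positivity
  have hgk : gS u * (1 - gS u) = (Real.sqrt (Hq u) / (3 * (1 + u))) ^ 2 := by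
    rw [div_pow, hs2]; simp only [gS, Hq]; field_simp; ring
  have h := hasDerivAt_arccos_sqrt hg hpos hk hgk
  refine (h.congr_deriv ?_).congr_of_eventuallyEq (Filter.Eventually.of_forall fun x => by simp [ThS])
  field_simp; ring

/-- derivative formula for `ThP` (B₄ evaluation, calculus layer). [folklore] -/
theorem hasDerivAt_ThP : HasDerivAt ThP (-(2 / (3 - 2 * u)) * (1 / Real.sqrt (Hq u))) u := by
  have hs := sHq_pos hu0 hu1; have hs2 := sHq_sq hu0 hu1
  have hg : HasDerivAt gP ((2 * (3 * (3 - 2 * u)) - (1 + 2 * u) * (3 * (-2))) / (3 * (3 - 2 * u)) ^ 2) u := by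
    have h1 : HasDerivAt (fun x => 1 + 2 * x) 2 u := ((hasDerivAt_id u).const_mul 2).const_add 1 |>.congr_deriv (by simp)
    have h2 : HasDerivAt (fun x => 3 * (3 - 2 * x)) (3 * (-2)) u :=
      (((hasDerivAt_id u).const_mul 2).const_sub 3).const_mul 3 |>.congr_deriv (by simp)
    have h := h1.div h2 (by nlinarith)
    exact h.congr_of_eventuallyEq (Filter.Eventually.of_forall fun x => by simp [gP])
  have hpos : 0 < gP u := by simp only [gP]; apply div_pos <;> nlinarith
  have hk : 0 < 2 * Real.sqrt (Hq u) / (3 * (3 - 2 * u)) := by apply div_pos <;> nlinarith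
  have h32 : (3 - 2 * u) ≠ 0 := (by linarith : (0:ℝ) < 3 - 2 * u).ne'
  have hgk : gP u * (1 - gP u) = (2 * Real.sqrt (Hq u) / (3 * (3 - 2 * u))) ^ 2 := by
    rw [div_pow, mul_pow, hs2]; simp only [gP, Hq]; field_simp; ring
  have h := hasDerivAt_arccos_sqrt hg hpos hk hgk
  refine (h.congr_deriv ?_).congr_of_eventuallyEq (Filter.Eventually.of_forall fun x => by simp [ThP])
  field_simp; ring

/-- derivative formula for `ThQ` (B₄ evaluation, calculus layer). [folklore] -/
theorem hasDerivAt_ThQ : HasDerivAt ThQ ((4 * u - 1) / ((1 + u) * (3 - 2 * u)) * (1 / Real.sqrt (Hq u))) u := by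
  have hs := sHq_pos hu0 hu1; have hs2 := sHq_sq hu0 hu1
  have hden : 0 < (1 + u) * (3 - 2 * u) := by nlinarith
  have hg : HasDerivAt gQ ((((-1) * (1 + 2 * u) + (1 - u) * 2) * ((1 + u) * (3 - 2 * u)) -
      (1 - u) * (1 + 2 * u) * (1 * (3 - 2 * u) + (1 + u) * (-2))) / ((1 + u) * (3 - 2 * u)) ^ 2) u := by
    have h1 : HasDerivAt (fun x => (1 - x) * (1 + 2 * x)) ((-1) * (1 + 2 * u) + (1 - u) * 2) u :=
      ((hasDerivAt_id u).const_sub 1).mul (((hasDerivAt_id u).const_mul 2).const_add 1) |>.congr_deriv (by simp)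
    have h2 : HasDerivAt (fun x => (1 + x) * (3 - 2 * x)) (1 * (3 - 2 * u) + (1 + u) * (-2)) u :=
      ((hasDerivAt_id u).const_add 1).mul (((hasDerivAt_id u).const_mul 2).const_sub 3) |>.congr_deriv (by simp)
    have h := h1.div h2 hden.ne'
    exact h.congr_of_eventuallyEq (Filter.Eventually.of_forall fun x => by simp [gQ])
  have hpos : 0 < gQ u := by simp only [gQ]; apply div_pos <;> nlinarith
  have hk : 0 < Real.sqrt (Hq u) / ((1 + u) * (3 - 2 * u)) := div_pos hs hden
  have h32 : (3 - u * 2) ≠ 0 := (by linarith : (0:ℝ) < 3 - u * 2).ne'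
  have h1u : (1 + u) ≠ 0 := (by linarith : (0:ℝ) < 1 + u).ne'
  have hgk : gQ u * (1 - gQ u) = (Real.sqrt (Hq u) / ((1 + u) * (3 - 2 * u))) ^ 2 := by
    rw [div_pow, mul_pow, hs2]; simp only [gQ, Hq]; field_simp; ring
  have h := hasDerivAt_arccos_sqrt hg hpos hk hgk
  refine (h.congr_deriv ?_).congr_of_eventuallyEq (Filter.Eventually.of_forall fun x => by simp [ThQ])
  field_simp; ring

/-- derivative formula for `I0q` (B₄ evaluation, calculus layer). [folklore] -/
theorem hasDerivAt_I0q : HasDerivAt I0q (1 / Real.sqrt (Hq u)) u := by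
  have hs := sHq_pos hu0 hu1; have hs2 := sHq_sq hu0 hu1
  have hf : HasDerivAt (fun x => (4 * x - 1) / 3) (4 / 3) u :=
    (((hasDerivAt_id u).const_mul 4).sub_const 1).div_const 3 |>.congr_deriv (by simp)
  have hg : 0 < 2 * Real.sqrt (Hq u) / 3 := by positivity
  have hfg : 1 - ((4 * u - 1) / 3) ^ 2 = (2 * Real.sqrt (Hq u) / 3) ^ 2 := by
    rw [div_pow, div_pow, mul_pow, hs2]; simp only [Hq]; ring
  have h := (hasDerivAt_arcsin_comp hf hg hfg).const_mul (1 / 2)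
  refine (h.congr_deriv ?_).congr_of_eventuallyEq (Filter.Eventually.of_forall fun x => by simp [I0q])
  field_simp; ring

/-- derivative formula for `Jm` (B₄ evaluation, calculus layer). [folklore] -/
theorem hasDerivAt_Jm : HasDerivAt Jm (1 / (1 + u) * (1 / Real.sqrt (Hq u))) u := by
  have hs := sHq_pos hu0 hu1; have hs2 := sHq_sq hu0 hu1
  have hu' : 0 < 1 + u := by linarith
  have hf : HasDerivAt (fun x => (4 / (1 + x) - 5) / 3) ((-(4 * 1) / (1 + u) ^ 2) / 3) u := by
    have h1 : HasDerivAt (fun x => 4 / (1 + x)) (-(4 * 1) / (1 + u) ^ 2) u :=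
      (hasDerivAt_const u (4:ℝ)).div ((hasDerivAt_id u).const_add 1) hu'.ne' |>.congr_deriv (by simp)
    exact (h1.sub_const 5).div_const 3
  have hg : 0 < 2 * Real.sqrt (Hq u) / (3 * (1 + u)) := by positivity
  have hfg : 1 - ((4 / (1 + u) - 5) / 3) ^ 2 = (2 * Real.sqrt (Hq u) / (3 * (1 + u))) ^ 2 := by
    rw [div_pow, div_pow, mul_pow, hs2]; simp only [Hq]; field_simp; ring
  have h := (hasDerivAt_arcsin_comp hf hg hfg).const_mul (-(1 / 2))
  refine (h.congr_deriv ?_).congr_of_eventuallyEq (Filter.Eventually.of_forall fun x => by simp [Jm])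
  field_simp; ring

/-- derivative formula for `Om` (B₄ evaluation, calculus layer). [folklore] -/
theorem hasDerivAt_Om : HasDerivAt Om (-(Real.sqrt 2 * Real.sqrt (1 - u) / (1 + u)) * (1 / Real.sqrt (Hq u))) u := by
  have hs := sHq_pos hu0 hu1; have hs2 := sHq_sq hu0 hu1
  have hu' : 0 < 1 + u := by linarith
  have ht : 0 < Real.sqrt (1 - u) := Real.sqrt_pos.mpr (by linarith)
  have ht2 : Real.sqrt (1 - u) ^ 2 = 1 - u := Real.sq_sqrt (by linarith)
  have h22 : Real.sqrt 2 ^ 2 = 2 := Real.sq_sqrt (by norm_num)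
  have hf : HasDerivAt (fun x => x / (1 + x)) ((1 * (1 + u) - u * 1) / (1 + u) ^ 2) u :=
    (hasDerivAt_id u).div ((hasDerivAt_id u).const_add 1) hu'.ne' |>.congr_deriv (by simp)
  have hg : 0 < Real.sqrt (Hq u) / (Real.sqrt 2 * Real.sqrt (1 - u) * (1 + u)) := by positivity
  have h1u' : (1 - u) ≠ 0 := (by linarith : (0:ℝ) < 1 - u).ne'
  have hfg : 1 - (u / (1 + u)) ^ 2 = (Real.sqrt (Hq u) / (Real.sqrt 2 * Real.sqrt (1 - u) * (1 + u))) ^ 2 := by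
    rw [div_pow, div_pow, mul_pow, mul_pow, hs2, ht2, h22]; simp only [Hq]; field_simp; ring
  have h := hasDerivAt_arccos_comp hf hg hfg
  refine (h.congr_deriv ?_).congr_of_eventuallyEq (Filter.Eventually.of_forall fun x => by simp [Om])
  field_simp; ring

omit hu0 in
/-- derivative formula for `Uf` (B₄ evaluation, calculus layer). [folklore] -/
theorem hasDerivAt_Uf : HasDerivAt Uf ((1 - u) * Real.sqrt (1 - u) * (1 - u - 10)) u := by
  have ht : 0 < Real.sqrt (1 - u) := Real.sqrt_pos.mpr (by linarith)
  have ht2 : Real.sqrt (1 - u) ^ 2 = 1 - u := Real.sq_sqrt (by linarith)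
  have h1 : HasDerivAt (fun x => (1 - x) ^ 2) (2 * (1 - u) * (-1)) u := by
    have := ((hasDerivAt_id u).const_sub 1).pow 2; exact this.congr_deriv (by simp)
  have h2 : HasDerivAt (fun x => Real.sqrt (1 - x)) ((-1) / (2 * Real.sqrt (1 - u))) u := by
    have := ((hasDerivAt_id u).const_sub 1).sqrt (by linarith : 1 - u ≠ 0); exact this.congr_deriv (by simp)
  have h3 : HasDerivAt (fun x => 4 - (2/7 : ℝ) * (1 - x)) (-((2/7 : ℝ) * (-1))) u := by
    have := (((hasDerivAt_id u).const_sub 1).const_mul (2/7 : ℝ)).const_sub 4; exact this.congr_deriv (by simp)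
  have h := (h1.mul h2).mul h3
  refine (h.congr_deriv ?_).congr_of_eventuallyEq (Filter.Eventually.of_forall fun x => by simp [Uf])
  simp only [Pi.mul_apply]
  field_simp
  rw [ht2]
  ring

/-- derivative formula for `asf` (B₄ evaluation, calculus layer). [folklore] -/
theorem hasDerivAt_asf : HasDerivAt asf (-((2 * u + 1) / (1 + u)) * (1 / Real.sqrt (Hq u))) u := by
  have hs := sHq_pos hu0 hu1; have hs2 := sHq_sq hu0 hu1
  have hu' : 0 < 1 + u := by linarith
  have hg : HasDerivAt rXi ((((-1) * (4 * u + 5) ^ 2 + (1 - u) * (2 * (4 * u + 5) * 4)) * (27 * (1 + u)) -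
      (1 - u) * (4 * u + 5) ^ 2 * (27 * 1)) / (27 * (1 + u)) ^ 2) u := by
    have h1 : HasDerivAt (fun x => (1 - x) * (4 * x + 5) ^ 2) ((-1) * (4 * u + 5) ^ 2 + (1 - u) * (2 * (4 * u + 5) * 4)) u := by
      have := ((hasDerivAt_id u).const_sub 1).mul ((((hasDerivAt_id u).const_mul 4).add_const 5).pow 2)
      exact this.congr_deriv (by simp)
    have h2 : HasDerivAt (fun x => 27 * (1 + x)) (27 * 1) u := ((hasDerivAt_id u).const_add 1).const_mul 27 |>.congr_deriv (by simp)
    have h := h1.div h2 (by positivity)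
    exact h.congr_of_eventuallyEq (Filter.Eventually.of_forall fun x => by simp [rXi])
  have hpos : 0 < rXi u := by
    simp only [rXi]
    exact div_pos (mul_pos (by linarith) (by positivity)) (by linarith)
  have hk : 0 < (4 * u + 5) * (1 + 2 * u) * Real.sqrt (Hq u) / (27 * (1 + u)) := by positivity
  have hgk : rXi u * (1 - rXi u) = ((4 * u + 5) * (1 + 2 * u) * Real.sqrt (Hq u) / (27 * (1 + u))) ^ 2 := by
    rw [div_pow, mul_pow, mul_pow, hs2]; simp only [rXi, Hq]; field_simp; ring
  have h := hasDerivAt_arcsin_sqrt hg hpos hk hgk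
  refine (h.congr_deriv ?_).congr_of_eventuallyEq (Filter.Eventually.of_forall fun x => by simp [asf])
  field_simp; ring


/-! ### key identity and `G' = Iu` -/
omit hu0 hu1 in
/-- auxiliary identity `key_identity_outer` of the explicit B₄ evaluation. [folklore] -/
theorem key_identity_outer (u : ℝ) (h1u : 1 + u ≠ 0) (h32 : 3 - u * 2 ≠ 0) (hP : 1 - u ^ 2 ≠ 0) :
    -(SsP u * (1 / (1 + u)) + SpP u * (-(2 / (3 - 2 * u))) + SqP u * ((4 * u - 1) / ((1 + u) * (3 - 2 * u)))) +
      2 / 15 * (u - 1) * ((2 * u + 1) / (1 + u)) -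
      4 / 15 * (1 - u) ^ 3 * (4 - (2/7 : ℝ) * (1 - u)) / (1 + u) +
      ((((-1)/20 : ℝ) * u ^ 2 + ((-1)/105 : ℝ) * u + (23/168 : ℝ)) * Hq u + EqP u * (2 - 8 * u) / 2 +
        (9/14 : ℝ) + (148/21 : ℝ) * (1 / (1 + u))) +
      Etot u * Hq u / (2 * (1 - u ^ 2)) = 0 := by
  simp only [SsP, SpP, SqP, EqP, Etot, Hq]
  field_simp
  ring

set_option maxRecDepth 8000 in
/-- derivative formula for `G` (B₄ evaluation, calculus layer). [folklore] -/
theorem hasDerivAt_G : HasDerivAt G (Iu u) u := by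
  have hs := sHq_pos hu0 hu1; have hs2 := sHq_sq hu0 hu1
  obtain ⟨s, hsdef⟩ : ∃ s, s = Real.sqrt (Hq u) := ⟨_, rfl⟩
  obtain ⟨t, htdef⟩ : ∃ t, t = Real.sqrt (1 - u) := ⟨_, rfl⟩
  have hs0 : 0 < s := by rw [hsdef]; exact hs
  have hs2' : s ^ 2 = Hq u := by rw [hsdef]; exact hs2
  have ht2 : t ^ 2 = 1 - u := by rw [htdef]; exact Real.sq_sqrt (by linarith)
  have h22 : Real.sqrt 2 ^ 2 = 2 := Real.sq_sqrt (by norm_num)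
  have hA : HasDerivAt (fun x => π ^ 2 * x / 5) (π ^ 2 * 1 / 5) u := ((hasDerivAt_id u).const_mul (π ^ 2)).div_const 5
  have hB := (hasDerivAt_csInt u).const_mul (π ^ 2 / 2)
  have hThS := hasDerivAt_ThS hu0 hu1; have hThP := hasDerivAt_ThP hu0 hu1; have hThQ := hasDerivAt_ThQ hu0 hu1
  rw [← hsdef] at hThS hThP hThQ
  have hC := (((hasDerivAt_SsP u).mul hThS).add ((hasDerivAt_SpP u).mul hThP)).add ((hasDerivAt_SqP u).mul hThQ)
    |>.const_mul π
  have hasf := hasDerivAt_asf hu0 hu1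
  rw [← hsdef] at hasf
  have hD := (((hasDerivAt_id u).sub_const 1).const_mul (-(2 * π / 15))).mul hasf
  have hOm := hasDerivAt_Om hu0 hu1
  rw [← hsdef, ← htdef] at hOm
  have hUf := hasDerivAt_Uf hu1
  rw [← htdef] at hUf
  have hE := (hUf.const_mul (2 * Real.sqrt 2 / 15 * π)).mul hOm
  have hsq : HasDerivAt (fun x => Real.sqrt (Hq x)) ((2 - 8 * u) / (2 * s)) u := by
    rw [hsdef]; exact (hasDerivAt_Hq u).sqrt (Hq_pos' hu0 hu1).ne'
  have hI0 := hasDerivAt_I0q hu0 hu1; have hJm := hasDerivAt_Jm hu0 hu1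
  rw [← hsdef] at hI0 hJm
  have hF := (((hasDerivAt_EqP u).mul hsq).add (hI0.const_mul (9/14 : ℝ))).add (hJm.const_mul (148/21 : ℝ))
    |>.const_mul π
  have hG := ((((hA.add hB).sub hC).add hD).add hE).add hF
  have hG' : HasDerivAt G _ u := hG.congr_of_eventuallyEq (Filter.Eventually.of_forall fun x => by
    simp only [G, Pi.add_apply, Pi.mul_apply, Pi.sub_apply, id])
  refine hG'.congr_deriv ?_
  have hk := key_identity_outer u (by linarith : (0:ℝ) < 1 + u).ne' (by linarith : (0:ℝ) < 3 - u * 2).ne'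
    (by nlinarith : (0:ℝ) < 1 - u ^ 2).ne'
  have e1 : (((-1)/20 : ℝ) * u ^ 2 + ((-1)/105 : ℝ) * u + (23/168 : ℝ)) * s =
      (((-1)/20 : ℝ) * u ^ 2 + ((-1)/105 : ℝ) * u + (23/168 : ℝ)) * Hq u / s := by
    rw [eq_div_iff hs0.ne', mul_assoc, ← sq, hs2']
  have e2 : π / (2 * (1 - u ^ 2)) * Etot u * s = π / (2 * (1 - u ^ 2)) * Etot u * Hq u / s := by
    rw [eq_div_iff hs0.ne', mul_assoc, ← sq, hs2']
  simp only [Iu, Uf]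
  rw [← hsdef, ← htdef, e1, e2]
  simp only [id]
  linear_combination (π / s) * hk +
    (-(2 / 15) * π * (1 - u) ^ 2 * (4 - (2/7 : ℝ) * (1 - u)) * Real.sqrt 2 ^ 2 * (1 / (1 + u)) * (1 / s)) * ht2 +
    (-(2 / 15) * π * (1 - u) ^ 3 * (4 - (2/7 : ℝ) * (1 - u)) * (1 / (1 + u)) * (1 / s)) * h22

end

/-! ### continuity of `G` on `[1/2, 1]` -/
/-- continuity statement `continuousOn_G` (B₄ evaluation, calculus layer). [folklore] -/
theorem continuousOn_G : ContinuousOn G (Icc (1/2 : ℝ) 1) := by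
  have h1 : ∀ x ∈ Icc (1/2 : ℝ) 1, (1 : ℝ) + x ≠ 0 := fun x hx => by linarith [hx.1]
  have h3 : ∀ x ∈ Icc (1/2 : ℝ) 1, (3 : ℝ) - 2 * x ≠ 0 := fun x hx => by linarith [hx.2]
  have hgS : ContinuousOn gS (Icc (1/2 : ℝ) 1) := by
    apply ContinuousOn.div (by fun_prop) (by fun_prop); intro x hx; have := h1 x hx; positivity
  have hgP : ContinuousOn gP (Icc (1/2 : ℝ) 1) := by
    apply ContinuousOn.div (by fun_prop) (by fun_prop); intro x hx
    exact mul_ne_zero (by norm_num) (h3 x hx)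
  have hgQ : ContinuousOn gQ (Icc (1/2 : ℝ) 1) := by
    apply ContinuousOn.div (by fun_prop) (by fun_prop); intro x hx; exact mul_ne_zero (h1 x hx) (h3 x hx)
  have hrXi : ContinuousOn rXi (Icc (1/2 : ℝ) 1) := by
    apply ContinuousOn.div (by fun_prop) (by fun_prop); intro x hx; exact mul_ne_zero (by norm_num) (h1 x hx)
  have hThS : ContinuousOn ThS (Icc (1/2 : ℝ) 1) :=
    (Real.continuous_arccos.comp Real.continuous_sqrt).comp_continuousOn hgS
  have hThP : ContinuousOn ThP (Icc (1/2 : ℝ) 1) :=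
    (Real.continuous_arccos.comp Real.continuous_sqrt).comp_continuousOn hgP
  have hThQ : ContinuousOn ThQ (Icc (1/2 : ℝ) 1) :=
    (Real.continuous_arccos.comp Real.continuous_sqrt).comp_continuousOn hgQ
  have hasf : ContinuousOn asf (Icc (1/2 : ℝ) 1) :=
    (Real.continuous_arcsin.comp Real.continuous_sqrt).comp_continuousOn hrXi
  have hI0q : Continuous I0q := by unfold I0q; fun_prop
  have hJm : ContinuousOn Jm (Icc (1/2 : ℝ) 1) := by
    have : ContinuousOn (fun u : ℝ => (4 / (1 + u) - 5) / 3) (Icc (1/2 : ℝ) 1) := by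
      apply ContinuousOn.div_const
      apply ContinuousOn.sub _ continuousOn_const
      exact ContinuousOn.div continuousOn_const (by fun_prop) h1
    exact (Real.continuous_arcsin.comp_continuousOn this).const_smul (-(1/2 : ℝ)) |>.congr
      (fun x _ => by simp [Jm])
  have hOm : ContinuousOn Om (Icc (1/2 : ℝ) 1) :=
    Real.continuous_arccos.comp_continuousOn (ContinuousOn.div continuousOn_id (by fun_prop) h1)
  have hUf : Continuous Uf := by unfold Uf; fun_prop
  have hsq : Continuous fun u => Real.sqrt (Hq u) := by unfold Hq; fun_prop
  unfold G
  apply ContinuousOn.add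
  · apply ContinuousOn.add
    · apply ContinuousOn.add
      · apply ContinuousOn.sub
          (by unfold csInt; fun_prop : Continuous fun u => π ^ 2 * u / 5 + π ^ 2 / 2 * csInt u).continuousOn
        apply ContinuousOn.mul continuousOn_const
        apply ContinuousOn.add (ContinuousOn.add ?_ ?_) ?_
        · exact ContinuousOn.mul (by unfold SsP; fun_prop) hThS
        · exact ContinuousOn.mul (by unfold SpP; fun_prop) hThP
        · exact ContinuousOn.mul (by unfold SqP; fun_prop) hThQ
      · exact ContinuousOn.mul (by fun_prop) hasf
    · exact ContinuousOn.mul (by fun_prop) hOm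
  · apply ContinuousOn.mul continuousOn_const
    apply ContinuousOn.add (ContinuousOn.add ?_ (by fun_prop)) (ContinuousOn.mul continuousOn_const hJm)
    exact (by unfold EqP; fun_prop : Continuous fun u => EqP u * Real.sqrt (Hq u)).continuousOn

/-! ### endpoint values -/
/-- auxiliary identity `sqrt_one_ninth` of the explicit B₄ evaluation. [folklore] -/
theorem sqrt_one_ninth : Real.sqrt (1 / 9) = 1 / 3 := by
  rw [show (1/9 : ℝ) = (1/3) ^ 2 by norm_num, Real.sqrt_sq (by norm_num)]
/-- auxiliary identity `sqrt_49_81` of the explicit B₄ evaluation. [folklore] -/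
theorem sqrt_49_81 : Real.sqrt (49 / 81) = 7 / 9 := by
  rw [show (49/81 : ℝ) = (7/9) ^ 2 by norm_num, Real.sqrt_sq (by norm_num)]
/-- auxiliary identity `sqrt_half` of the explicit B₄ evaluation. [folklore] -/
theorem sqrt_half : Real.sqrt (1 / 2) = Real.sqrt 2 / 2 := by
  rw [show (1/2 : ℝ) = 2 / 2 ^ 2 by norm_num, Real.sqrt_div' _ (by norm_num), Real.sqrt_sq (by norm_num)]

/-- `arccos √(1/3) = (π − arccos(1/3))/2` [folklore] -/
theorem arccos_sqrt_third : Real.arccos (Real.sqrt (1 / 3)) = (π - Real.arccos (1 / 3)) / 2 := by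
  set x := Real.arccos (Real.sqrt (1 / 3)) with hx
  have hx0 : 0 ≤ x := Real.arccos_nonneg _
  have hxle : x ≤ π / 2 := by
    rw [hx]; exact Real.arccos_le_pi_div_two.mpr (Real.sqrt_nonneg _)
  have hle1 : Real.sqrt (1/3) ≤ 1 := by
    rw [show (1:ℝ) = Real.sqrt 1 from Real.sqrt_one.symm]; exact Real.sqrt_le_sqrt (by norm_num)
  have hcos2 : Real.cos (2 * x) = -(1 / 3) := by
    rw [Real.cos_two_mul, hx, Real.cos_arccos (by linarith [Real.sqrt_nonneg (1/3 : ℝ)]) hle1,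
      Real.sq_sqrt (by norm_num)]; norm_num
  have h2x : 2 * x = Real.arccos (-(1 / 3)) := by
    rw [← hcos2, Real.arccos_cos (by linarith) (by linarith)]
  rw [Real.arccos_neg] at h2x
  linarith

/-- `arcsin (7/9) = 2 arccos(1/3) − π/2` [folklore] -/
theorem arcsin_seven_ninths : Real.arcsin (7 / 9) = 2 * Real.arccos (1 / 3) - π / 2 := by
  set θ := Real.arccos (1 / 3) with hθ
  have hθ0 : 0 ≤ θ := Real.arccos_nonneg _
  have hθle : θ ≤ π / 2 := by rw [hθ]; exact Real.arccos_le_pi_div_two.mpr (by norm_num)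
  have hcosθ : Real.cos θ = 1 / 3 := by rw [hθ, Real.cos_arccos (by norm_num) (by norm_num)]
  have hsin : Real.sin (2 * θ - π / 2) = 7 / 9 := by
    rw [Real.sin_sub_pi_div_two, Real.cos_two_mul, hcosθ]; norm_num
  rw [← hsin, Real.arcsin_sin (by linarith) (by linarith)]

/-- `arcsin (1/3) = π/2 − arccos(1/3)` [folklore] -/
theorem arcsin_third : Real.arcsin (1 / 3) = π / 2 - Real.arccos (1 / 3) :=
  Real.arcsin_eq_pi_div_two_sub_arccos _

/-- auxiliary identity `G_one` of the explicit B₄ evaluation. [folklore] -/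
theorem G_one : G 1 = π ^ 2 * (1 / 5 + 2 / 15 - 611 / 180 + 17 / 36 + 9 / 56 + 37 / 21) := by
  have hS : ThS 1 = π / 2 := by simp [ThS, gS]
  have hP : ThP 1 = 0 := by
    simp only [ThP, gP]; norm_num
  have hQ : ThQ 1 = π / 2 := by simp [ThQ, gQ]
  have hI : I0q 1 = π / 4 := by simp only [I0q]; norm_num [Real.arcsin_one]; ring
  have hJ : Jm 1 = π / 4 := by
    simp only [Jm]; norm_num [Real.arcsin_neg, Real.arcsin_one]; ring
  have hH : Real.sqrt (Hq 1) = 0 := by simp [Hq]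
  simp only [G, hS, hP, hQ, hI, hJ, hH, csInt, SsP, SpP, SqP, EqP, Uf]
  norm_num
  ring

/-- auxiliary identity `G_half` of the explicit B₄ evaluation. [folklore] -/
theorem G_half : G (1/2) = π ^ 2 / 10 + π ^ 2 / 2 * (7/15) -
    π * ((9637/1440 : ℝ) * Real.arccos (1/3) + ((-139)/180 : ℝ) * ((π - Real.arccos (1/3)) / 2) +
      ((-23)/36 : ℝ) * ((π - Real.arccos (1/3)) / 2)) +
    -(2 * π / 15) * (1/2 - 1) * (2 * Real.arccos (1/3) - π / 2) +
    2 * Real.sqrt 2 / 15 * π * ((27/28 : ℝ) * (Real.sqrt 2 / 2)) * Real.arccos (1/3) +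
    π * ((73/1680 : ℝ) * Real.sqrt 2 + (9/14 : ℝ) * (1 / 2 * (π / 2 - Real.arccos (1/3))) +
      (148/21 : ℝ) * (1 / 2 * (2 * Real.arccos (1/3) - π / 2))) := by
  have hS : ThS (1/2) = Real.arccos (1/3) := by
    simp only [ThS, gS]; norm_num [sqrt_one_ninth]
  have hP : ThP (1/2) = (π - Real.arccos (1/3)) / 2 := by
    have : gP (1/2) = 1/3 := by norm_num [gP]
    simp only [ThP, this, arccos_sqrt_third]
  have hQ : ThQ (1/2) = (π - Real.arccos (1/3)) / 2 := by
    have : gQ (1/2) = 1/3 := by norm_num [gQ]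
    simp only [ThQ, this, arccos_sqrt_third]
  have hasf : asf (1/2) = 2 * Real.arccos (1/3) - π / 2 := by
    simp only [asf, rXi]; norm_num [sqrt_49_81, arcsin_seven_ninths]
  have hUf : Uf (1/2) = (27/28 : ℝ) * (Real.sqrt 2 / 2) := by
    have h2 : (Real.sqrt 2)⁻¹ = Real.sqrt 2 / 2 := by
      have hne : Real.sqrt 2 ≠ 0 := by positivity
      rw [eq_div_iff (by norm_num : (2:ℝ) ≠ 0), inv_mul_eq_div, div_eq_iff hne]
      exact (Real.mul_self_sqrt (by norm_num : (0:ℝ) ≤ 2)).symm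
    simp only [Uf]; norm_num; rw [h2]; ring
  have hOm : Om (1/2) = Real.arccos (1/3) := by simp only [Om]; norm_num
  have hH : Real.sqrt (Hq (1/2)) = Real.sqrt 2 := by simp only [Hq]; norm_num
  have hI : I0q (1/2) = 1 / 2 * (π / 2 - Real.arccos (1/3)) := by
    simp only [I0q]; norm_num [arcsin_third]
  have hJ : Jm (1/2) = 1 / 2 * (2 * Real.arccos (1/3) - π / 2) := by
    simp only [Jm]; norm_num [Real.arcsin_neg, arcsin_seven_ninths]; ring
  simp only [G, hS, hP, hQ, hasf, hUf, hOm, hH, hI, hJ, csInt, SsP, SpP, SqP, EqP]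
  norm_num
  ring

/-- **the value of the outer integral**: `G 1 − G (1/2) = J` [folklore] -/
theorem G_one_sub_G_half :
    G 1 - G (1/2) = (459/1120 : ℝ) * π * Real.arccos (1/3) - (73/1680 : ℝ) * π * Real.sqrt 2
      - (89/1260 : ℝ) * π ^ 2 := by
  rw [G_one, G_half]
  have h22 : Real.sqrt 2 * Real.sqrt 2 = 2 := Real.mul_self_sqrt (by norm_num)
  ring_nf
  rw [show Real.sqrt 2 ^ 2 = 2 from Real.sq_sqrt (by norm_num)]
  ring


end OUT

end BoltzmannB4


namespace BoltzmannB4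

/-! ## Part 4f: bridges between the volume integrands and the calculus layers -/

/-- `√P · √Q = √(P Q)` rewriting inside the three arccos arguments turns `Mtri_sqrt_eq` into `IS.Ms`. [folklore] -/
theorem gs_eq_Ms {u v : ℝ} (hu : u ∈ Ioo (1/2 : ℝ) 1) (hv : v ∈ Ioo (1/2 : ℝ) 1)
    (hH : 0 < 3 - 4 * u ^ 2 - 4 * v ^ 2 + 4 * u * v) : gs u v = IS.Ms u v := by
  obtain ⟨hu1, hu2⟩ := hu; obtain ⟨hv1, hv2⟩ := hv
  have hP : 0 < 1 - u ^ 2 := by nlinarith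
  have hQ : 0 < 1 - v ^ 2 := by nlinarith
  have hW : 0 < 1 - (u - v) ^ 2 := by nlinarith
  have hH' : 0 ≤ 4 * (1 - u ^ 2) * (1 - v ^ 2) - ((1 - u ^ 2) + (1 - v ^ 2) - (1 - (u - v) ^ 2)) ^ 2 := by
    nlinarith
  rw [gs_eq_Mtri ⟨hu1, hu2⟩ ⟨hv1, hv2⟩ hH, Mtri_sqrt_eq hP hQ hW hH']
  simp only [IS.Ms, IS.As, IS.Aq, IS.Ap, IS.Ds, IS.Dq, IS.Dp, IS.Ns, IS.Nq, IS.Np, IS.Pf, IS.Qf, IS.Wf, IS.Hf]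
  rw [mul_assoc (2:ℝ) (Real.sqrt (1 - u ^ 2)) (Real.sqrt (1 - v ^ 2)), ← Real.sqrt_mul hP.le,
    mul_assoc (2:ℝ) (Real.sqrt (1 - u ^ 2)) (Real.sqrt (1 - (u - v) ^ 2)), ← Real.sqrt_mul hP.le,
    mul_assoc (2:ℝ) (Real.sqrt (1 - v ^ 2)) (Real.sqrt (1 - (u - v) ^ 2)), ← Real.sqrt_mul hQ.le]
  have hHeq : 4 * (1 - u ^ 2) * (1 - v ^ 2) - ((1 - u ^ 2) + (1 - v ^ 2) - (1 - (u - v) ^ 2)) ^ 2 =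
      3 - 4 * u ^ 2 - 4 * v ^ 2 + 4 * u * v := by ring
  rw [hHeq]

/-- cap region [folklore] -/
theorem gs_eq_capPQ {u v : ℝ} (hu : u ∈ Ioo (1/2 : ℝ) 1) (hv : v ∈ Ioo (1/2 : ℝ) 1)
    (hH : 3 - 4 * u ^ 2 - 4 * v ^ 2 + 4 * u * v ≤ 0) : gs u v = π ^ 2 * IS.Pf u * IS.Qf v := by
  rw [gs_eq_cap hu hv hH]; simp [IS.Pf, IS.Qf]

/-- `x = √y` from `0 ≤ x` and `x² = y` [folklore] -/
theorem eq_sqrt_of_sq_eq {x y : ℝ} (hx : 0 ≤ x) (h : x ^ 2 = y) : x = Real.sqrt y := by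
  rw [← h, Real.sqrt_sq hx]

/-- opposite side [folklore] -/
theorem go_eq_Mo {u v : ℝ} (hu : u ∈ Ioo (1/2 : ℝ) 1) (hv : v ∈ Ioo (1/2 : ℝ) 1) :
    go u v = IOp.Mo (1 - u) v := by
  obtain ⟨hu1, hu2⟩ := hu; obtain ⟨hv1, hv2⟩ := hv
  have hP : 0 < 1 - u ^ 2 := by nlinarith
  have hQ : 0 < 1 - v ^ 2 := by nlinarith
  have hW : 0 < 1 - (u + v - 1) ^ 2 := by nlinarith
  have hH' : 0 ≤ 4 * (1 - u ^ 2) * (1 - v ^ 2) - ((1 - u ^ 2) + (1 - v ^ 2) - (1 - (u + v - 1) ^ 2)) ^ 2 := by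
    nlinarith
  rw [go_eq_Mtri ⟨hu1, hu2⟩ ⟨hv1, hv2⟩, Mtri_sqrt_eq hP hQ hW hH']
  have hsP : 0 < Real.sqrt (1 - u ^ 2) := Real.sqrt_pos.mpr hP
  have hsQ : 0 < Real.sqrt (1 - v ^ 2) := Real.sqrt_pos.mpr hQ
  have hsW : 0 < Real.sqrt (1 - (u + v - 1) ^ 2) := Real.sqrt_pos.mpr hW
  have hsP2 := Real.sq_sqrt hP.le; have hsQ2 := Real.sq_sqrt hQ.le; have hsW2 := Real.sq_sqrt hW.le
  have h1u : (1 + u) ≠ 0 := by intro h; linarith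
  have h1v : (1 + v) ≠ 0 := by intro h; linarith
  have h2uv : (2 - u - v) ≠ 0 := by intro h; linarith
  have h1mv : (1 - v) ≠ 0 := by intro h; linarith
  have h1mu : (1 - u) ≠ 0 := by intro h; linarith
  have huv : (u + v) ≠ 0 := by intro h; linarith
  have hd1 : (2 - (1 - u)) ≠ 0 := by intro h; linarith
  have hd2 : (1 + (1 - u) - v) ≠ 0 := by intro h; linarith
  have hPn := hP.ne'; have hQn := hQ.ne'; have hWn := hW.ne'
  -- the three arccos arguments are the square roots of gso, gqo, gpo
  have e1 : (1 - u ^ 2 + (1 - v ^ 2) - (1 - (u + v - 1) ^ 2)) / (2 * Real.sqrt (1 - u ^ 2) * Real.sqrt (1 - v ^ 2))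
      = Real.sqrt (IOp.gso (1 - u) v) := by
    apply eq_sqrt_of_sq_eq
    · apply div_nonneg _ (by positivity); nlinarith
    · rw [div_pow, mul_pow, mul_pow, hsP2, hsQ2]; simp only [IOp.gso]; field_simp; ring
  have e2 : (1 - u ^ 2 + (1 - (u + v - 1) ^ 2) - (1 - v ^ 2)) /
      (2 * Real.sqrt (1 - u ^ 2) * Real.sqrt (1 - (u + v - 1) ^ 2)) = Real.sqrt (IOp.gqo (1 - u) v) := by
    apply eq_sqrt_of_sq_eq
    · apply div_nonneg _ (by positivity); nlinarith
    · rw [div_pow, mul_pow, mul_pow, hsP2, hsW2]; simp only [IOp.gqo]; field_simp; ring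
  have e3 : (1 - v ^ 2 + (1 - (u + v - 1) ^ 2) - (1 - u ^ 2)) /
      (2 * Real.sqrt (1 - v ^ 2) * Real.sqrt (1 - (u + v - 1) ^ 2)) = Real.sqrt (IOp.gpo (1 - u) v) := by
    apply eq_sqrt_of_sq_eq
    · apply div_nonneg _ (by positivity); nlinarith
    · rw [div_pow, mul_pow, mul_pow, hsQ2, hsW2]; simp only [IOp.gpo]; field_simp; ring
  rw [e1, e2, e3]
  have hHeq : 4 * (1 - u ^ 2) * (1 - v ^ 2) - ((1 - u ^ 2) + (1 - v ^ 2) - (1 - (u + v - 1) ^ 2)) ^ 2 =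
      IOp.Ho (1 - u) v := by simp only [IOp.Ho]; ring
  rw [hHeq]
  simp only [IOp.Mo, IOp.Aso, IOp.Aqo, IOp.Apo, IOp.Pa, IOp.Qf, IOp.Wo]
  ring

end BoltzmannB4

namespace BoltzmannB4

/-! ## Part 4g: the same-side inner integral `∫_{1/2}^1 gs u v dv` -/

/-- `ρ(u) = √(3(1−u²))`. [folklore] -/
def rho (u : ℝ) : ℝ := Real.sqrt (3 * IS.Pf u)
/-- the `H = 0` boundary `b(u) = (u + ρ(u))/2`. [folklore] -/
def bnd (u : ℝ) : ℝ := (u + rho u) / 2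

/-- auxiliary identity `Pf_pos` of the explicit B₄ evaluation. [folklore] -/
theorem Pf_pos {u : ℝ} (hu : u ∈ Ioo (1/2 : ℝ) 1) : 0 < IS.Pf u := by
  simp only [IS.Pf]; nlinarith [hu.1, hu.2]
/-- auxiliary identity `rho_pos` of the explicit B₄ evaluation. [folklore] -/
theorem rho_pos {u : ℝ} (hu : u ∈ Ioo (1/2 : ℝ) 1) : 0 < rho u :=
  Real.sqrt_pos.mpr (by have := Pf_pos hu; positivity)
/-- auxiliary identity `rho_sq` of the explicit B₄ evaluation. [folklore] -/
theorem rho_sq {u : ℝ} (hu : u ∈ Ioo (1/2 : ℝ) 1) : rho u ^ 2 = 3 * (1 - u ^ 2) := by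
  rw [rho, Real.sq_sqrt (by have := Pf_pos hu; positivity), IS.Pf]
/-- auxiliary identity `Hf_eq_rho` of the explicit B₄ evaluation. [folklore] -/
theorem Hf_eq_rho {u : ℝ} (hu : u ∈ Ioo (1/2 : ℝ) 1) (v : ℝ) :
    IS.Hf u v = (rho u - (2 * v - u)) * (rho u + (2 * v - u)) := by
  have := rho_sq hu; simp only [IS.Hf]; nlinarith
/-- auxiliary identity `half_lt_bnd` of the explicit B₄ evaluation. [folklore] -/
theorem half_lt_bnd {u : ℝ} (hu : u ∈ Ioo (1/2 : ℝ) 1) : 1/2 < bnd u := by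
  have h1 := rho_sq hu; have h2 := rho_pos hu
  have : 1 - u < rho u := by nlinarith [hu.1, hu.2]
  rw [bnd]; linarith
/-- auxiliary identity `bnd_lt_one` of the explicit B₄ evaluation. [folklore] -/
theorem bnd_lt_one {u : ℝ} (hu : u ∈ Ioo (1/2 : ℝ) 1) : bnd u < 1 := by
  have h1 := rho_sq hu; have h2 := rho_pos hu
  have : rho u < 2 - u := by nlinarith [hu.1, hu.2]
  rw [bnd]; linarith
/-- auxiliary identity `two_bnd_sub` of the explicit B₄ evaluation. [folklore] -/
theorem two_bnd_sub {u : ℝ} : 2 * bnd u - u = rho u := by rw [bnd]; ring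
/-- auxiliary identity `Hf_pos_of` of the explicit B₄ evaluation. [folklore] -/
theorem Hf_pos_of {u v : ℝ} (hu : u ∈ Ioo (1/2 : ℝ) 1) (hv : v ∈ Ioo (1/2 : ℝ) (bnd u)) : 0 < IS.Hf u v := by
  rw [Hf_eq_rho hu]
  have h2 := rho_pos hu; have := hv.2; have := hv.1; have hb : bnd u = (u + rho u) / 2 := rfl
  apply mul_pos <;> nlinarith [hu.1, hu.2]
/-- auxiliary identity `Hf_neg_of` of the explicit B₄ evaluation. [folklore] -/
theorem Hf_neg_of {u v : ℝ} (hu : u ∈ Ioo (1/2 : ℝ) 1) (hv : v ∈ Ioo (bnd u) 1) : IS.Hf u v < 0 := by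
  rw [Hf_eq_rho hu]
  have h2 := rho_pos hu; have := hv.2; have := hv.1; have hb : bnd u = (u + rho u) / 2 := rfl
  apply mul_neg_of_neg_of_pos <;> nlinarith [hu.1, hu.2]
/-- auxiliary identity `Hf_bnd` of the explicit B₄ evaluation. [folklore] -/
theorem Hf_bnd {u : ℝ} (hu : u ∈ Ioo (1/2 : ℝ) 1) : IS.Hf u (bnd u) = 0 := by
  rw [Hf_eq_rho hu, two_bnd_sub]; ring

/-- `gs u` is interval integrable on any interval. [folklore] -/
theorem intervalIntegrable_gs (u a b : ℝ) : IntervalIntegrable (gs u) volume a b := by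
  have hm : Measurable (gs u) := measurable_gs.of_uncurry_left
  apply IntegrableOn.intervalIntegrable
  refine Measure.integrableOn_of_bounded (M := π ^ 2) measure_Icc_lt_top.ne hm.aestronglyMeasurable ?_
  exact ae_of_all _ fun v => by rw [Real.norm_eq_abs, abs_of_nonneg (gs_nonneg u v)]; exact gs_le u v
/-- `go u` is interval integrable on any interval. [folklore] -/
theorem intervalIntegrable_go (u a b : ℝ) : IntervalIntegrable (go u) volume a b := by
  have hm : Measurable (go u) := measurable_go.of_uncurry_left
  apply IntegrableOn.intervalIntegrable
  refine Measure.integrableOn_of_bounded (M := π ^ 2) measure_Icc_lt_top.ne hm.aestronglyMeasurable ?_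
  exact ae_of_all _ fun v => by rw [Real.norm_eq_abs, abs_of_nonneg (go_nonneg u v)]; exact go_le u v

/-- continuity statement `continuous_poly5` (B₄ evaluation, calculus layer). [folklore] -/
theorem continuous_poly5 (c0 c1 c2 c3 c4 c5 : ℝ) : Continuous (poly5 c0 c1 c2 c3 c4 c5) := by
  have : poly5 c0 c1 c2 c3 c4 c5 = fun v => poly5 c0 c1 c2 c3 c4 c5 v := rfl
  rw [this]; simp only [poly5]; fun_prop

/-- continuity of the same-side antiderivative. [folklore] -/
theorem continuousAt_Fs {u x : ℝ} (hP : 0 < IS.Pf u) (hQ : 0 < IS.Qf x) (hW : 0 < IS.Wf u x)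
    (hx1 : x + 1 ≠ 0) (hx2 : x - 1 - u ≠ 0) : ContinuousAt (IS.Fs u) x := by
  have hcQ : Continuous IS.Qf := by
    rw [show IS.Qf = fun v => 1 - v ^ 2 from funext fun v => rfl]; fun_prop
  have hcW : Continuous (IS.Wf u) := by
    rw [show IS.Wf u = fun v => 1 - (u - v) ^ 2 from funext fun v => rfl]; fun_prop
  have hcH : Continuous (IS.Hf u) := by
    rw [show IS.Hf u = fun v => 3 - 4 * u ^ 2 - 4 * v ^ 2 + 4 * u * v from funext fun v => rfl]; fun_prop
  have hcDs : Continuous (IS.Ds u) := by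
    rw [show IS.Ds u = fun v => IS.Pf u * IS.Qf v from funext fun v => rfl]; fun_prop
  have hcDq : Continuous (IS.Dq u) := by
    rw [show IS.Dq u = fun v => IS.Pf u * IS.Wf u v from funext fun v => rfl]; fun_prop
  have hcDp : Continuous (IS.Dp u) := by
    rw [show IS.Dp u = fun v => IS.Qf v * IS.Wf u v from funext fun v => rfl]; fun_prop
  have hcNs : Continuous (IS.Ns u) := by
    rw [show IS.Ns u = fun v => IS.Pf u + IS.Qf v - IS.Wf u v from funext fun v => rfl]; fun_prop
  have hcNq : Continuous (IS.Nq u) := by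
    rw [show IS.Nq u = fun v => IS.Pf u + IS.Wf u v - IS.Qf v from funext fun v => rfl]; fun_prop
  have hcNp : Continuous (IS.Np u) := by
    rw [show IS.Np u = fun v => IS.Qf v + IS.Wf u v - IS.Pf u from funext fun v => rfl]; fun_prop
  have hcRs : Continuous (IS.Rs u) := continuous_poly5 ..
  have hcRq : Continuous (IS.Rq u) := continuous_poly5 ..
  have hcRp : Continuous (IS.Rp u) := continuous_poly5 ..
  have hcEs : Continuous (IS.Es u) := continuous_poly5 ..
  have hDs : 2 * Real.sqrt (IS.Ds u x) ≠ 0 :=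
    mul_ne_zero two_ne_zero (Real.sqrt_pos.mpr (by simp only [IS.Ds]; positivity)).ne'
  have hDq : 2 * Real.sqrt (IS.Dq u x) ≠ 0 :=
    mul_ne_zero two_ne_zero (Real.sqrt_pos.mpr (by simp only [IS.Dq]; positivity)).ne'
  have hDp : 2 * Real.sqrt (IS.Dp u x) ≠ 0 :=
    mul_ne_zero two_ne_zero (Real.sqrt_pos.mpr (by simp only [IS.Dp]; positivity)).ne'
  have hr : Real.sqrt (3 * IS.Pf u) ≠ 0 := (Real.sqrt_pos.mpr (by positivity)).ne'
  have hr2 : 2 * Real.sqrt (3 * IS.Pf u) ≠ 0 := mul_ne_zero two_ne_zero hr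
  have hP2 : 2 * IS.Pf u ≠ 0 := by positivity
  unfold IS.Fs IS.As IS.Aq IS.Ap IS.I0s IS.Jms IS.Jps
  fun_prop (disch := assumption)

/-- continuity of the same-side closed-form integrand. [folklore] -/
theorem continuousAt_Ms {u x : ℝ} (hP : 0 < IS.Pf u) (hQ : 0 < IS.Qf x) (hW : 0 < IS.Wf u x) :
    ContinuousAt (IS.Ms u) x := by
  have hcQ : Continuous IS.Qf := by
    rw [show IS.Qf = fun v => 1 - v ^ 2 from funext fun v => rfl]; fun_prop
  have hcW : Continuous (IS.Wf u) := by
    rw [show IS.Wf u = fun v => 1 - (u - v) ^ 2 from funext fun v => rfl]; fun_prop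
  have hcH : Continuous (IS.Hf u) := by
    rw [show IS.Hf u = fun v => 3 - 4 * u ^ 2 - 4 * v ^ 2 + 4 * u * v from funext fun v => rfl]; fun_prop
  have hcDs : Continuous (IS.Ds u) := by
    rw [show IS.Ds u = fun v => IS.Pf u * IS.Qf v from funext fun v => rfl]; fun_prop
  have hcDq : Continuous (IS.Dq u) := by
    rw [show IS.Dq u = fun v => IS.Pf u * IS.Wf u v from funext fun v => rfl]; fun_prop
  have hcDp : Continuous (IS.Dp u) := by
    rw [show IS.Dp u = fun v => IS.Qf v * IS.Wf u v from funext fun v => rfl]; fun_prop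
  have hcNs : Continuous (IS.Ns u) := by
    rw [show IS.Ns u = fun v => IS.Pf u + IS.Qf v - IS.Wf u v from funext fun v => rfl]; fun_prop
  have hcNq : Continuous (IS.Nq u) := by
    rw [show IS.Nq u = fun v => IS.Pf u + IS.Wf u v - IS.Qf v from funext fun v => rfl]; fun_prop
  have hcNp : Continuous (IS.Np u) := by
    rw [show IS.Np u = fun v => IS.Qf v + IS.Wf u v - IS.Pf u from funext fun v => rfl]; fun_prop
  have hDs : 2 * Real.sqrt (IS.Ds u x) ≠ 0 :=
    mul_ne_zero two_ne_zero (Real.sqrt_pos.mpr (by simp only [IS.Ds]; positivity)).ne'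
  have hDq : 2 * Real.sqrt (IS.Dq u x) ≠ 0 :=
    mul_ne_zero two_ne_zero (Real.sqrt_pos.mpr (by simp only [IS.Dq]; positivity)).ne'
  have hDp : 2 * Real.sqrt (IS.Dp u x) ≠ 0 :=
    mul_ne_zero two_ne_zero (Real.sqrt_pos.mpr (by simp only [IS.Dp]; positivity)).ne'
  unfold IS.Ms IS.As IS.Aq IS.Ap
  fun_prop (disch := assumption)

end BoltzmannB4

namespace BoltzmannB4

/-- auxiliary identity `four_Ds_sub` of the explicit B₄ evaluation. [folklore] -/
theorem four_Ds_sub (u v : ℝ) : 4 * IS.Ds u v - IS.Ns u v ^ 2 = IS.Hf u v := by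
  simp only [IS.Ds, IS.Ns, IS.Hf, IS.Pf, IS.Qf, IS.Wf]; ring
/-- auxiliary identity `four_Dq_sub` of the explicit B₄ evaluation. [folklore] -/
theorem four_Dq_sub (u v : ℝ) : 4 * IS.Dq u v - IS.Nq u v ^ 2 = IS.Hf u v := by
  simp only [IS.Dq, IS.Nq, IS.Hf, IS.Pf, IS.Qf, IS.Wf]; ring
/-- auxiliary identity `four_Dp_sub` of the explicit B₄ evaluation. [folklore] -/
theorem four_Dp_sub (u v : ℝ) : 4 * IS.Dp u v - IS.Np u v ^ 2 = IS.Hf u v := by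
  simp only [IS.Dp, IS.Np, IS.Hf, IS.Pf, IS.Qf, IS.Wf]; ring

/-- auxiliary identity `Ns_bnd_neg` of the explicit B₄ evaluation. [folklore] -/
theorem Ns_bnd_neg {u : ℝ} (hu : u ∈ Ioo (1/2 : ℝ) 1) : IS.Ns u (bnd u) < 0 := by
  have hρ := rho_pos hu; have hρ2 := rho_sq hu
  have hP : 0 < 1 - u ^ 2 := by nlinarith [hu.1, hu.2]
  have hu0 : 0 < u := by linarith [hu.1]
  have hpos : 0 < u * rho u + (1 - u ^ 2) := by positivity
  have e : u * rho u - (1 - u ^ 2) = (1 - u ^ 2) * (4 * u ^ 2 - 1) / (u * rho u + (1 - u ^ 2)) := by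
    rw [eq_div_iff hpos.ne']; linear_combination u ^ 2 * hρ2
  have h4 : 0 < 4 * u ^ 2 - 1 := by nlinarith [hu.1]
  have : 0 < u * rho u - (1 - u ^ 2) := by rw [e]; positivity
  have hN : IS.Ns u (bnd u) = 1 - u * (u + rho u) := by simp only [IS.Ns, IS.Pf, IS.Qf, IS.Wf, bnd]; ring
  rw [hN]; nlinarith
/-- auxiliary identity `Nq_bnd_pos` of the explicit B₄ evaluation. [folklore] -/
theorem Nq_bnd_pos {u : ℝ} (hu : u ∈ Ioo (1/2 : ℝ) 1) : 0 < IS.Nq u (bnd u) := by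
  have hρ := rho_pos hu
  have hP : 0 < 1 - u ^ 2 := by nlinarith [hu.1, hu.2]
  have hu0 : 0 < u := by linarith [hu.1]
  have hN : IS.Nq u (bnd u) = (1 - u ^ 2) + u * rho u := by simp only [IS.Nq, IS.Pf, IS.Qf, IS.Wf, bnd]; ring
  rw [hN]; positivity
/-- auxiliary identity `Np_bnd_pos` of the explicit B₄ evaluation. [folklore] -/
theorem Np_bnd_pos {u : ℝ} (hu : u ∈ Ioo (1/2 : ℝ) 1) : 0 < IS.Np u (bnd u) := by
  have hρ2 := rho_sq hu
  have hN : IS.Np u (bnd u) = (4 * u ^ 2 - 1) / 2 := by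
    simp only [IS.Np, IS.Pf, IS.Qf, IS.Wf, bnd]; linear_combination (-(1:ℝ)/2) * hρ2
  rw [hN]; nlinarith [hu.1]

/-- auxiliary identity `As_bnd` of the explicit B₄ evaluation. [folklore] -/
theorem As_bnd {u : ℝ} (hu : u ∈ Ioo (1/2 : ℝ) 1) : IS.As u (bnd u) = π := by
  have hN := Ns_bnd_neg hu
  have hN0 : IS.Ns u (bnd u) ≠ 0 := hN.ne
  have hD : IS.Ds u (bnd u) = (-(IS.Ns u (bnd u)) / 2) ^ 2 := by
    linear_combination (1/4 : ℝ) * (four_Ds_sub u (bnd u)) + (1/4 : ℝ) * Hf_bnd hu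
  rw [IS.As, hD, Real.sqrt_sq (by linarith)]
  rw [show IS.Ns u (bnd u) / (2 * (-IS.Ns u (bnd u) / 2)) = -1 by field_simp]
  exact Real.arccos_neg_one
/-- auxiliary identity `Aq_bnd` of the explicit B₄ evaluation. [folklore] -/
theorem Aq_bnd {u : ℝ} (hu : u ∈ Ioo (1/2 : ℝ) 1) : IS.Aq u (bnd u) = 0 := by
  have hN := Nq_bnd_pos hu
  have hN0 : IS.Nq u (bnd u) ≠ 0 := hN.ne'
  have hD : IS.Dq u (bnd u) = (IS.Nq u (bnd u) / 2) ^ 2 := by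
    linear_combination (1/4 : ℝ) * (four_Dq_sub u (bnd u)) + (1/4 : ℝ) * Hf_bnd hu
  rw [IS.Aq, hD, Real.sqrt_sq (by linarith)]
  rw [show IS.Nq u (bnd u) / (2 * (IS.Nq u (bnd u) / 2)) = 1 by field_simp]
  exact Real.arccos_one
/-- auxiliary identity `Ap_bnd` of the explicit B₄ evaluation. [folklore] -/
theorem Ap_bnd {u : ℝ} (hu : u ∈ Ioo (1/2 : ℝ) 1) : IS.Ap u (bnd u) = 0 := by
  have hN := Np_bnd_pos hu
  have hN0 : IS.Np u (bnd u) ≠ 0 := hN.ne'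
  have hD : IS.Dp u (bnd u) = (IS.Np u (bnd u) / 2) ^ 2 := by
    linear_combination (1/4 : ℝ) * (four_Dp_sub u (bnd u)) + (1/4 : ℝ) * Hf_bnd hu
  rw [IS.Ap, hD, Real.sqrt_sq (by linarith)]
  rw [show IS.Np u (bnd u) / (2 * (IS.Np u (bnd u) / 2)) = 1 by field_simp]
  exact Real.arccos_one
/-- auxiliary identity `I0s_bnd` of the explicit B₄ evaluation. [folklore] -/
theorem I0s_bnd {u : ℝ} (hu : u ∈ Ioo (1/2 : ℝ) 1) : IS.I0s u (bnd u) = π / 4 := by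
  have hρ := rho_pos hu
  rw [IS.I0s, show Real.sqrt (3 * IS.Pf u) = rho u from rfl, two_bnd_sub, div_self hρ.ne', Real.arcsin_one]
  ring
/-- auxiliary identity `Jms_bnd` of the explicit B₄ evaluation. [folklore] -/
theorem Jms_bnd {u : ℝ} (hu : u ∈ Ioo (1/2 : ℝ) 1) : IS.Jms u (bnd u) = π / (2 * (2 * u + 1)) := by
  have hρ := rho_pos hu
  have hb1 : bnd u + 1 ≠ 0 := by have := half_lt_bnd hu; intro h; linarith
  have key : (2 * u + 1) ^ 2 = 2 * (bnd u + 1) * (2 + u - rho u) := by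
    simp only [bnd]; linear_combination rho_sq hu
  have harg : ((2 * u + 1) ^ 2 / (bnd u + 1) - 2 * (2 + u)) / (2 * Real.sqrt (3 * IS.Pf u)) = -1 := by
    rw [show Real.sqrt (3 * IS.Pf u) = rho u from rfl, key]; field_simp; ring
  rw [IS.Jms, harg, Real.arcsin_neg, Real.arcsin_one]
  have : (2 * u + 1) ≠ 0 := by intro h; linarith [hu.1]
  field_simp
/-- auxiliary identity `Jps_bnd` of the explicit B₄ evaluation. [folklore] -/
theorem Jps_bnd {u : ℝ} (hu : u ∈ Ioo (1/2 : ℝ) 1) : IS.Jps u (bnd u) = π / (2 * (2 * u + 1)) := by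
  have hρ := rho_pos hu
  have hb1 : bnd u - 1 - u ≠ 0 := by have := bnd_lt_one hu; intro h; linarith [hu.1]
  have key : (2 * u + 1) ^ 2 = -2 * (bnd u - 1 - u) * (rho u + 2 + u) := by
    simp only [bnd]; linear_combination rho_sq hu
  have harg : ((2 * u + 1) ^ 2 / (bnd u - 1 - u) + 2 * (2 + u)) / (2 * Real.sqrt (3 * IS.Pf u)) = -1 := by
    rw [show Real.sqrt (3 * IS.Pf u) = rho u from rfl, key]; field_simp; ring
  rw [IS.Jps, harg, Real.arcsin_neg, Real.arcsin_one]
  have : (2 * u + 1) ≠ 0 := by intro h; linarith [hu.1]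
  field_simp

/-- the value of the antiderivative on the boundary `H = 0`. [folklore] -/
theorem Fs_bnd {u : ℝ} (hu : u ∈ Ioo (1/2 : ℝ) 1) :
    IS.Fs u (bnd u) = π ^ 2 * IS.Rs u (bnd u) - 11 / 60 * π ^ 2 := by
  have hP := Pf_pos hu
  have h2u : (2 * u + 1) ≠ 0 := by intro h; linarith [hu.1]
  rw [IS.Fs, As_bnd hu, Aq_bnd hu, Ap_bnd hu, I0s_bnd hu, Jms_bnd hu, Jps_bnd hu, Hf_bnd hu, Real.sqrt_zero]
  field_simp
  ring

/-- the cap part of the same-side integral. [folklore] -/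
theorem integral_gs_cap {u : ℝ} (hu : u ∈ Ioo (1/2 : ℝ) 1) :
    ∫ v in bnd u..1, gs u v = π ^ 2 * IS.Pf u * (2 / 3 - bnd u + bnd u ^ 3 / 3) := by
  have hle := (bnd_lt_one hu).le
  have h1 : ∫ v in bnd u..1, gs u v = ∫ v in bnd u..1, π ^ 2 * IS.Pf u * (1 - v ^ 2) := by
    simp only [intervalIntegral.integral_of_le hle, integral_Ioc_eq_integral_Ioo]
    refine setIntegral_congr_fun measurableSet_Ioo fun v hv => ?_
    have hv' : v ∈ Ioo (1/2 : ℝ) 1 := ⟨(half_lt_bnd hu).trans hv.1, hv.2⟩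
    rw [gs_eq_capPQ hu hv' (Hf_neg_of hu hv).le]; simp only [IS.Qf]
  rw [h1, intervalIntegral.integral_const_mul, intervalIntegral.integral_sub intervalIntegrable_const
    (intervalIntegral.intervalIntegrable_pow 2), intervalIntegral.integral_const, integral_pow]
  simp only [smul_eq_mul]; ring

/-- the triangle part of the same-side integral (fundamental theorem of calculus). [folklore] -/
theorem integral_gs_tri {u : ℝ} (hu : u ∈ Ioo (1/2 : ℝ) 1) :
    ∫ v in (1/2 : ℝ)..bnd u, gs u v = IS.Fs u (bnd u) - IS.Fs u (1/2) := by
  have hle := (half_lt_bnd hu).le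
  have hb1 := bnd_lt_one hu
  have hP := Pf_pos hu
  have h1 : ∫ v in (1/2 : ℝ)..bnd u, gs u v = ∫ v in (1/2 : ℝ)..bnd u, IS.Ms u v := by
    simp only [intervalIntegral.integral_of_le hle, integral_Ioc_eq_integral_Ioo]
    refine setIntegral_congr_fun measurableSet_Ioo fun v hv => ?_
    exact gs_eq_Ms hu ⟨hv.1, hv.2.trans hb1⟩ (Hf_pos_of hu hv)
  rw [h1]
  have hQ : ∀ x ∈ Icc (1/2 : ℝ) (bnd u), 0 < IS.Qf x := fun x hx => by
    simp only [IS.Qf]; nlinarith [hx.1, hx.2]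
  have hW : ∀ x ∈ Icc (1/2 : ℝ) (bnd u), 0 < IS.Wf u x := fun x hx => by
    simp only [IS.Wf]; nlinarith [hx.1, hx.2, hu.1, hu.2]
  apply intervalIntegral.integral_eq_sub_of_hasDerivAt_of_le hle
  · exact fun x hx => (continuousAt_Fs hP (hQ x hx) (hW x hx) (by linarith [hx.1] : (0:ℝ) < x + 1).ne'
      (by linarith [hx.2, hu.1] : x - 1 - u < 0).ne).continuousWithinAt
  · intro x hx
    exact IS.hasDerivAt_Fs hP (hQ x (Ioo_subset_Icc_self hx)) (hW x (Ioo_subset_Icc_self hx))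
      (Hf_pos_of hu hx) (by linarith [hu.1]) (by linarith [hx.1]) (by linarith [hx.2, hu.1])
  · apply ContinuousOn.intervalIntegrable
    rw [uIcc_of_le hle]
    exact fun x hx => (continuousAt_Ms hP (hQ x hx) (hW x hx)).continuousWithinAt

/-- the same-side inner integral. [folklore] -/
theorem integral_gs_total {u : ℝ} (hu : u ∈ Ioo (1/2 : ℝ) 1) :
    ∫ v in (1/2 : ℝ)..1, gs u v = -(11 / 60) * π ^ 2 - IS.Fs u (1/2) := by
  rw [← intervalIntegral.integral_add_adjacent_intervals (intervalIntegrable_gs u (1/2) (bnd u))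
    (intervalIntegrable_gs u (bnd u) 1), integral_gs_tri hu, integral_gs_cap hu, Fs_bnd hu]
  have : π ^ 2 * IS.Rs u (bnd u) + π ^ 2 * IS.Pf u * (2 / 3 - bnd u + bnd u ^ 3 / 3) = 0 := by
    simp only [IS.Rs, poly5, IS.Pf]; ring
  linarith

end BoltzmannB4

namespace BoltzmannB4

/-! ## Part 4h: the opposite-side inner integral `∫_{1/2}^1 go u v dv` -/

/-- continuity of the opposite-side antiderivative. [folklore] -/
theorem continuousAt_Fo {a x : ℝ} (ha0 : 0 < a) (ha1 : a < 1) (hx0 : 0 < 1 + x) (hw : 0 < 1 + a - x) :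
    ContinuousAt (IOp.Fo a) x := by
  have hcQ : Continuous IOp.Qf := by
    rw [show IOp.Qf = fun v => 1 - v ^ 2 from funext fun v => rfl]; fun_prop
  have hcW : Continuous (IOp.Wo a) := by
    rw [show IOp.Wo a = fun v => 1 - (v - a) ^ 2 from funext fun v => rfl]; fun_prop
  have hcH : Continuous (IOp.Ho a) := by
    rw [show IOp.Ho a = fun v => 8 * a * (1 - v) * (1 - a + v) from funext fun v => rfl]; fun_prop
  have hcRs : Continuous (IOp.Rso a) := continuous_poly5 ..
  have hcRq : Continuous (IOp.Rqo a) := continuous_poly5 ..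
  have hcRp : Continuous (IOp.Rpo a) := continuous_poly5 ..
  have hcE : Continuous (IOp.Eo a) := continuous_poly5 ..
  have h2a : (2 : ℝ) - a ≠ 0 := by intro h; linarith
  have h1 : (2 - a) * (1 + x) ≠ 0 := mul_ne_zero h2a hx0.ne'
  have h2 : (1 + x) * (1 + a - x) ≠ 0 := mul_ne_zero hx0.ne' hw.ne'
  have h3 : (2 - a) * (1 + a - x) ≠ 0 := mul_ne_zero h2a hw.ne'
  have h4 : 2 * Real.sqrt (2 * a) ≠ 0 := mul_ne_zero two_ne_zero (Real.sqrt_pos.mpr (by positivity)).ne'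
  have h5 : 2 * IOp.Pa a ≠ 0 := by simp only [IOp.Pa]; positivity
  unfold IOp.Fo IOp.Aso IOp.Apo IOp.Aqo IOp.gso IOp.gpo IOp.gqo IOp.I0o
  fun_prop (disch := assumption)

/-- continuity of the opposite-side closed-form integrand. [folklore] -/
theorem continuousAt_Mo {a x : ℝ} (ha0 : 0 < a) (ha1 : a < 1) (hx0 : 0 < 1 + x) (hw : 0 < 1 + a - x) :
    ContinuousAt (IOp.Mo a) x := by
  have hcQ : Continuous IOp.Qf := by
    rw [show IOp.Qf = fun v => 1 - v ^ 2 from funext fun v => rfl]; fun_prop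
  have hcW : Continuous (IOp.Wo a) := by
    rw [show IOp.Wo a = fun v => 1 - (v - a) ^ 2 from funext fun v => rfl]; fun_prop
  have hcH : Continuous (IOp.Ho a) := by
    rw [show IOp.Ho a = fun v => 8 * a * (1 - v) * (1 - a + v) from funext fun v => rfl]; fun_prop
  have h2a : (2 : ℝ) - a ≠ 0 := by intro h; linarith
  have h1 : (2 - a) * (1 + x) ≠ 0 := mul_ne_zero h2a hx0.ne'
  have h2 : (1 + x) * (1 + a - x) ≠ 0 := mul_ne_zero hx0.ne' hw.ne'
  have h3 : (2 - a) * (1 + a - x) ≠ 0 := mul_ne_zero h2a hw.ne'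
  unfold IOp.Mo IOp.Aso IOp.Apo IOp.Aqo IOp.gso IOp.gpo IOp.gqo
  fun_prop (disch := assumption)

/-- the opposite-side inner integral (fundamental theorem of calculus). [folklore] -/
theorem integral_go_total {u : ℝ} (hu : u ∈ Ioo (1/2 : ℝ) 1) :
    ∫ v in (1/2 : ℝ)..1, go u v = IOp.Fo (1 - u) 1 - IOp.Fo (1 - u) (1/2) := by
  have hle : (1/2 : ℝ) ≤ 1 := by norm_num
  have ha0 : 0 < 1 - u := by linarith [hu.2]
  have ha1 : 1 - u < 1 := by linarith [hu.1]
  have h1 : ∫ v in (1/2 : ℝ)..1, go u v = ∫ v in (1/2 : ℝ)..1, IOp.Mo (1 - u) v := by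
    simp only [intervalIntegral.integral_of_le hle, integral_Ioc_eq_integral_Ioo]
    exact setIntegral_congr_fun measurableSet_Ioo fun v hv => go_eq_Mo hu hv
  rw [h1]
  apply intervalIntegral.integral_eq_sub_of_hasDerivAt_of_le hle
  · exact fun x hx => (continuousAt_Fo ha0 ha1 (by linarith [hx.1]) (by linarith [hx.2, hu.2])).continuousWithinAt
  · intro x hx
    exact IOp.hasDerivAt_Fo ha0 ha1 (by linarith [hx.1]) hx.2 (by linarith [hx.1, hu.1])
  · apply ContinuousOn.intervalIntegrable
    rw [uIcc_of_le hle]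
    exact fun x hx => (continuousAt_Mo ha0 ha1 (by linarith [hx.1]) (by linarith [hx.2, hu.2])).continuousWithinAt

/-! ## Part 4i: the values at `v = 1/2` and `v = 1` in terms of the outer-layer functions -/

section bridge
variable {u : ℝ} (hu : u ∈ Ioo (1/2 : ℝ) 1)
include hu

/-- auxiliary identity `As_half` of the explicit B₄ evaluation. [folklore] -/
theorem As_half : IS.As u (1/2) = OUT.ThS u := by
  have hP : 0 < 1 - u ^ 2 := by nlinarith [hu.1, hu.2]
  have h1u : (1:ℝ) + u ≠ 0 := by intro h; linarith [hu.1]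
  have h1u' : (1:ℝ) - u ≠ 0 := by intro h; linarith [hu.2]
  have hD : 0 < IS.Ds u (1/2) := by simp only [IS.Ds, IS.Pf, IS.Qf]; nlinarith
  rw [IS.As, OUT.ThS]; congr 1
  apply eq_sqrt_of_sq_eq
  · apply div_nonneg _ (by positivity); simp only [IS.Ns, IS.Pf, IS.Qf, IS.Wf]; nlinarith [hu.2]
  · rw [div_pow, mul_pow, Real.sq_sqrt hD.le]; simp only [IS.Ns, IS.Ds, IS.Pf, IS.Qf, IS.Wf, OUT.gS]
    have : (1:ℝ) - u ^ 2 = (1 - u) * (1 + u) := by ring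
    rw [this]; field_simp; ring
/-- auxiliary identity `Aq_half` of the explicit B₄ evaluation. [folklore] -/
theorem Aq_half : IS.Aq u (1/2) = OUT.ThQ u := by
  have h1u : (1:ℝ) + u ≠ 0 := by intro h; linarith [hu.1]
  have h1u' : (1:ℝ) - u ≠ 0 := by intro h; linarith [hu.2]
  have h32 : (3:ℝ) - 2 * u ≠ 0 := by intro h; linarith [hu.2]
  have h12 : (1:ℝ) + 2 * u ≠ 0 := by intro h; linarith [hu.1]
  have hN : IS.Nq u (1/2) = (1 - u) * (1 + 2 * u) := by simp only [IS.Nq, IS.Pf, IS.Qf, IS.Wf]; ring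
  have hD' : IS.Dq u (1/2) = (1 - u) * (1 + u) * ((1 + 2 * u) * (3 - 2 * u)) / 4 := by
    simp only [IS.Dq, IS.Pf, IS.Wf]; ring
  have hD : 0 < IS.Dq u (1/2) := by
    rw [hD']; have := hu.1; have := hu.2
    apply div_pos _ (by norm_num)
    apply mul_pos (mul_pos (by linarith) (by linarith)) (mul_pos (by linarith) (by linarith))
  rw [IS.Aq, OUT.ThQ]; congr 1
  apply eq_sqrt_of_sq_eq
  · apply div_nonneg _ (by positivity); rw [hN]; have := hu.1; have := hu.2
    apply mul_nonneg (by linarith) (by linarith)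
  · rw [div_pow, mul_pow, Real.sq_sqrt hD.le, hN, hD']; simp only [OUT.gQ]
    field_simp; ring
/-- auxiliary identity `Ap_half` of the explicit B₄ evaluation. [folklore] -/
theorem Ap_half : IS.Ap u (1/2) = OUT.ThP u := by
  have h32 : (3:ℝ) - 2 * u ≠ 0 := by intro h; linarith [hu.2]
  have h12 : (1:ℝ) + 2 * u ≠ 0 := by intro h; linarith [hu.1]
  have hD : 0 < IS.Dp u (1/2) := by simp only [IS.Dp, IS.Qf, IS.Wf]; nlinarith [hu.1, hu.2]
  rw [IS.Ap, OUT.ThP]; congr 1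
  apply eq_sqrt_of_sq_eq
  · apply div_nonneg _ (by positivity); simp only [IS.Np, IS.Pf, IS.Qf, IS.Wf]; nlinarith [hu.1, hu.2]
  · rw [div_pow, mul_pow, Real.sq_sqrt hD.le]; simp only [IS.Np, IS.Dp, IS.Pf, IS.Qf, IS.Wf, OUT.gP]
    have e2 : (1:ℝ) - (u - 1/2) ^ 2 = (1 + 2 * u) * (3 - 2 * u) / 4 := by ring
    rw [e2]; field_simp; ring
omit hu in
/-- auxiliary identity `sqrtHf_half` of the explicit B₄ evaluation. [folklore] -/
theorem sqrtHf_half : Real.sqrt (IS.Hf u (1/2)) = Real.sqrt (OUT.Hq u) := by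
  congr 1; simp only [IS.Hf, OUT.Hq]; ring
/-- `(1−u)/√(3(1−u²)) = √gS` [folklore] -/
theorem quot_eq_sqrt_gS : (1 - u) / Real.sqrt (3 * IS.Pf u) = Real.sqrt (OUT.gS u) := by
  have hP : 0 < 1 - u ^ 2 := by nlinarith [hu.1, hu.2]
  have h1u : (1:ℝ) + u ≠ 0 := by intro h; linarith [hu.1]
  have h1u' : (1:ℝ) - u ≠ 0 := by intro h; linarith [hu.2]
  have h3 : 0 < 3 * IS.Pf u := by simp only [IS.Pf]; linarith
  apply eq_sqrt_of_sq_eq (div_nonneg (by linarith [hu.2]) (Real.sqrt_nonneg _))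
  rw [div_pow, Real.sq_sqrt h3.le]; simp only [IS.Pf, OUT.gS]
  have e1 : (1:ℝ) - u ^ 2 = (1 - u) * (1 + u) := by ring
  rw [e1]; field_simp
/-- auxiliary identity `I0s_half` of the explicit B₄ evaluation. [folklore] -/
theorem I0s_half : IS.I0s u (1/2) = 1 / 2 * (π / 2 - OUT.ThS u) := by
  rw [IS.I0s, show (2 * (1/2 : ℝ) - u) = 1 - u by ring, quot_eq_sqrt_gS hu,
    Real.arcsin_eq_pi_div_two_sub_arccos, OUT.ThS]
/-- auxiliary identity `Jps_half` of the explicit B₄ evaluation. [folklore] -/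
theorem Jps_half : IS.Jps u (1/2) = -(1 / (2 * u + 1)) * (π / 2 - OUT.ThS u) := by
  have hρ : Real.sqrt (3 * IS.Pf u) ≠ 0 := (rho_pos hu).ne'
  have hd : ((1:ℝ)/2 - 1 - u) ≠ 0 := by intro h; linarith [hu.1]
  have harg : ((2 * u + 1) ^ 2 / (1/2 - 1 - u) + 2 * (2 + u)) / (2 * Real.sqrt (3 * IS.Pf u)) =
      (1 - u) / Real.sqrt (3 * IS.Pf u) := by
    rw [div_eq_div_iff (mul_ne_zero two_ne_zero hρ) hρ]
    have : (2 * u + 1) ^ 2 / (1/2 - 1 - u) = -(2 * (2 * u + 1)) := by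
      rw [div_eq_iff hd]; ring
    rw [this]; ring
  rw [IS.Jps, harg, quot_eq_sqrt_gS hu, Real.arcsin_eq_pi_div_two_sub_arccos, OUT.ThS]
/-- auxiliary identity `Jms_half` of the explicit B₄ evaluation. [folklore] -/
theorem Jms_half : IS.Jms u (1/2) = 1 / (2 * u + 1) * OUT.asf u := by
  have hP : 0 < 1 - u ^ 2 := by nlinarith [hu.1, hu.2]
  have hρ0 : 0 < Real.sqrt (3 * IS.Pf u) := rho_pos hu
  have h3 : 0 < 3 * IS.Pf u := by simp only [IS.Pf]; linarith
  have hd : ((1:ℝ)/2 + 1) ≠ 0 := by norm_num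
  have h1u : (1:ℝ) + u ≠ 0 := by intro h; linarith [hu.1]
  have h1u' : (1:ℝ) - u ≠ 0 := by intro h; linarith [hu.2]
  -- the argument is `-√rXi`
  have hnum : (2 * u + 1) ^ 2 / (1/2 + 1) - 2 * (2 + u) = -(2 * (1 - u) * (4 * u + 5) / 3) := by
    field_simp; ring
  have harg : ((2 * u + 1) ^ 2 / (1/2 + 1) - 2 * (2 + u)) / (2 * Real.sqrt (3 * IS.Pf u)) =
      -Real.sqrt (OUT.rXi u) := by
    rw [hnum, neg_div, neg_inj]
    apply eq_sqrt_of_sq_eq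
    · apply div_nonneg _ (by positivity); apply div_nonneg _ (by norm_num)
      have := hu.1; have := hu.2; positivity
    · rw [div_pow, mul_pow, Real.sq_sqrt h3.le]; simp only [IS.Pf, OUT.rXi]
      have e1 : (1:ℝ) - u ^ 2 = (1 - u) * (1 + u) := by ring
      rw [e1]; field_simp; ring
  rw [IS.Jms, harg, Real.arcsin_neg, OUT.asf]; ring

/-- auxiliary identity `Aso_half` of the explicit B₄ evaluation. [folklore] -/
theorem Aso_half : IOp.Aso (1 - u) (1/2) = OUT.ThS u := by
  have h1u : (1:ℝ) + u ≠ 0 := by intro h; linarith [hu.1]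
  have hd1 : (2:ℝ) - (1 - u) ≠ 0 := by intro h; linarith [hu.1]
  have hd3 : (1:ℝ) + 1/2 ≠ 0 := by norm_num
  rw [IOp.Aso, OUT.ThS, IOp.gso, OUT.gS]; congr 2; field_simp; ring
/-- auxiliary identity `Aqo_half` of the explicit B₄ evaluation. [folklore] -/
theorem Aqo_half : IOp.Aqo (1 - u) (1/2) = OUT.ThQ u := by
  have h1u : (1:ℝ) + u ≠ 0 := by intro h; linarith [hu.1]
  have h32 : (3:ℝ) - 2 * u ≠ 0 := by intro h; linarith [hu.2]
  have hd1 : (2:ℝ) - (1 - u) ≠ 0 := by intro h; linarith [hu.1]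
  have hd2 : (1:ℝ) + (1 - u) - 1/2 ≠ 0 := by intro h; linarith [hu.2]
  rw [IOp.Aqo, OUT.ThQ, IOp.gqo, OUT.gQ]; congr 2; field_simp; ring
/-- auxiliary identity `Apo_half` of the explicit B₄ evaluation. [folklore] -/
theorem Apo_half : IOp.Apo (1 - u) (1/2) = OUT.ThP u := by
  have h32 : (3:ℝ) - 2 * u ≠ 0 := by intro h; linarith [hu.2]
  have hd2 : (1:ℝ) + (1 - u) - 1/2 ≠ 0 := by intro h; linarith [hu.2]
  have hd3 : (1:ℝ) + 1/2 ≠ 0 := by norm_num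
  rw [IOp.Apo, OUT.ThP, IOp.gpo, OUT.gP]; congr 2; field_simp; ring
omit hu in
/-- auxiliary identity `sqrtHo_half` of the explicit B₄ evaluation. [folklore] -/
theorem sqrtHo_half : Real.sqrt (IOp.Ho (1 - u) (1/2)) = Real.sqrt (OUT.Hq u) := by
  congr 1; simp only [IOp.Ho, OUT.Hq]; ring
omit hu in
/-- auxiliary identity `Aso_one` of the explicit B₄ evaluation. [folklore] -/
theorem Aso_one : IOp.Aso (1 - u) 1 = π / 2 := by
  rw [IOp.Aso, IOp.gso]; simp
/-- auxiliary identity `Aqo_one` of the explicit B₄ evaluation. [folklore] -/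
theorem Aqo_one : IOp.Aqo (1 - u) 1 = 0 := by
  have hd1 : (2:ℝ) - (1 - u) ≠ 0 := by intro h; linarith [hu.1]
  have hd2 : (1:ℝ) - u ≠ 0 := by intro h; linarith [hu.2]
  have hd3 : (1:ℝ) + (1 - u) - 1 ≠ 0 := by intro h; linarith [hu.2]
  rw [IOp.Aqo, IOp.gqo, show (1 - (1 - u) + 1) * (1 - u) / ((2 - (1 - u)) * (1 + (1 - u) - 1)) = 1 from by
    rw [div_eq_one_iff_eq (mul_ne_zero hd1 hd3)]; ring]
  simp
omit hu in
/-- auxiliary identity `Ho_one` of the explicit B₄ evaluation. [folklore] -/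
theorem Ho_one : IOp.Ho (1 - u) 1 = 0 := by simp [IOp.Ho]
/-- auxiliary identity `I0o_one` of the explicit B₄ evaluation. [folklore] -/
theorem I0o_one : IOp.I0o (1 - u) 1 = 1 / (2 * Real.sqrt (2 * (1 - u))) * (π / 2) := by
  have hd1 : (2:ℝ) - (1 - u) ≠ 0 := by intro h; linarith [hu.1]
  rw [IOp.I0o, show (2 * 1 - (1 - u)) / (2 - (1 - u)) = (1:ℝ) from by rw [div_eq_one_iff_eq hd1]; ring,
    Real.arcsin_one]
/-- auxiliary identity `I0o_half` of the explicit B₄ evaluation. [folklore] -/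
theorem I0o_half : IOp.I0o (1 - u) (1/2) = 1 / (2 * Real.sqrt (2 * (1 - u))) * (π / 2 - OUT.Om u) := by
  have hd1 : (2:ℝ) - (1 - u) ≠ 0 := by intro h; linarith [hu.1]
  have h1u : (1:ℝ) + u ≠ 0 := by intro h; linarith [hu.1]
  rw [IOp.I0o, show (2 * (1/2) - (1 - u)) / (2 - (1 - u)) = u / (1 + u) by field_simp; ring,
    OUT.Om, Real.arccos_eq_pi_div_two_sub_arcsin]; ring
/-- `1/(2√(2a)) = √2·√a/(4a)` [folklore] -/
theorem inv_two_sqrt : 1 / (2 * Real.sqrt (2 * (1 - u))) = Real.sqrt 2 * Real.sqrt (1 - u) / (4 * (1 - u)) := by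
  have ha : 0 < 1 - u := by linarith [hu.2]
  have h2 : Real.sqrt 2 * Real.sqrt 2 = 2 := Real.mul_self_sqrt (by norm_num)
  have ha' : Real.sqrt (1 - u) * Real.sqrt (1 - u) = 1 - u := Real.mul_self_sqrt ha.le
  have hs2 : 0 < Real.sqrt 2 := by positivity
  have hsa : 0 < Real.sqrt (1 - u) := Real.sqrt_pos.mpr ha
  rw [Real.sqrt_mul (by norm_num), div_eq_div_iff (by positivity) (by positivity)]
  linear_combination (-2 * (Real.sqrt (1 - u)) ^ 2) * h2 - 4 * ha'

/-- the algebraic heart of the bridge: inner results expressed through the outer integrand. [folklore] -/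
theorem bridge_alg :
    -(11 / 60) * π ^ 2 - IS.Fs u (1/2) + (IOp.Fo (1 - u) 1 - IOp.Fo (1 - u) (1/2)) = OUT.Iu u := by
  have h1u : (1:ℝ) + u ≠ 0 := by intro h; linarith [hu.1]
  have h1u' : (1:ℝ) - u ≠ 0 := by intro h; linarith [hu.2]
  have h2u : (2:ℝ) * u + 1 ≠ 0 := by intro h; linarith [hu.1]
  have hd1 : (2:ℝ) - (1 - u) ≠ 0 := by intro h; linarith [hu.1]
  have hP : (1:ℝ) - u ^ 2 ≠ 0 := by have : 0 < 1 - u ^ 2 := by nlinarith [hu.1, hu.2]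
                                    exact this.ne'
  rw [IS.Fs, IOp.Fo, IOp.Fo, As_half hu, Aq_half hu, Ap_half hu, sqrtHf_half, I0s_half hu, Jps_half hu,
    Jms_half hu, Aso_half hu, Aqo_half hu, Apo_half hu, sqrtHo_half, Aso_one, Aqo_one hu, Ho_one,
    Real.sqrt_zero, I0o_one hu, I0o_half hu, inv_two_sqrt hu]
  simp only [OUT.Iu, IS.Rs, IS.Rq, IS.Rp, IS.Es, IOp.Rso, IOp.Rqo, IOp.Rpo, IOp.Eo, IOp.kapo, poly5, IS.Pf, IOp.Pa,
    OUT.rhoS, OUT.rhoQ, OUT.rhoP, OUT.Etot, OUT.csO]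
  field_simp
  ring

end bridge

end BoltzmannB4

namespace BoltzmannB4

/-! ## Part 4j: the outer integral and the final assembly -/

/-- the full inner integral in closed form: `∫_{1/2}^1 (gs + go) dv = Iu(u)` on `(1/2, 1)`. [folklore] -/
theorem inner_total {u : ℝ} (hu : u ∈ Ioo (1/2 : ℝ) 1) :
    ∫ v in (1/2 : ℝ)..1, (gs u v + go u v) = OUT.Iu u := by
  rw [intervalIntegral.integral_add (intervalIntegrable_gs u _ _) (intervalIntegrable_go u _ _),
    integral_gs_total hu, integral_go_total hu]
  linarith [bridge_alg hu]

/-- the inner integral is an integrable function of `u`. [folklore] -/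
theorem intervalIntegrable_inner :
    IntervalIntegrable (fun u => ∫ v in (1/2 : ℝ)..1, (gs u v + go u v)) volume (1/2) 1 := by
  have h : Integrable (fun w : ℝ × ℝ => gs w.1 w.2 + go w.1 w.2)
      ((volume.restrict (Icc (1/2 : ℝ) 1)).prod (volume.restrict (Icc (1/2 : ℝ) 1))) := by
    rw [Measure.prod_restrict, ← Measure.volume_eq_prod]; exact integrableOn_gsgo
  have h2 := h.integral_prod_left
  apply IntegrableOn.intervalIntegrable
  rw [uIcc_of_le (by norm_num : (1/2 : ℝ) ≤ 1)]
  refine (h2.congr (ae_of_all _ fun u => ?_) : IntegrableOn _ _ _)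
  simp only
  rw [intervalIntegral.integral_of_le (by norm_num : (1/2 : ℝ) ≤ 1), integral_Icc_eq_integral_Ioc]

/-- **The two-dimensional integral in closed form**:
`∫_{1/2}^1 ∫_{1/2}^1 (gs + go) = G(1) − G(1/2)`. [folklore] -/
theorem integral_J :
    ∫ u in (1/2 : ℝ)..1, ∫ v in (1/2 : ℝ)..1, (gs u v + go u v) = OUT.G 1 - OUT.G (1/2) :=
  intervalIntegral.integral_eq_sub_of_hasDerivAt_of_le (by norm_num) OUT.continuousOn_G
    (fun _ hx => (OUT.hasDerivAt_G hx.1 hx.2).congr_deriv (inner_total hx).symm) intervalIntegrable_inner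

/-- **The complete star in closed form**:
`vol(hardSphereStarFour) = (16π/3)·((459/1120)π·arccos(1/3) − (73/1680)π√2 − (89/1260)π²)`.
[cite: Lyberg2005, §3–§4, Table I (D = 3 complete-star value, equivalent to Nijboer–van Hove 1952)] -/
theorem volume_hardSphereStarFour_toReal :
    (volume hardSphereStarFour).toReal =
      16 * π / 3 * ((459/1120 : ℝ) * π * Real.arccos (1/3) - (73/1680 : ℝ) * π * Real.sqrt 2
        - (89/1260 : ℝ) * π ^ 2) := by
  rw [volume_hardSphereStarFour_eq_integral, integral_J, OUT.G_one_sub_G_half]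

end BoltzmannB4

/-- **Boltzmann's fourth virial coefficient of hard spheres** (discharge of the named fact
`Boltzmann1899_B4_hardSpheres_dim3`):
`B₄/B₂³ = 2707/4480 + (219/2240)(√2/π) − (4131/4480)(arccos(1/3)/π)`, assembled from the ring
(`2176π³/2835`), diamond (`6347π³/11340`) and complete-star values of the three Mayer diagrams.
[cite: Lyberg2005, §1 eq. for B₄ and §3–§4 (D = 3)] -/
theorem Boltzmann1899_B4_hardSpheres_dim3_holds : Boltzmann1899_B4_hardSpheres_dim3 := by
  unfold Boltzmann1899_B4_hardSpheres_dim3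
  rw [volume_hardSphereRingFour_toReal, volume_hardSphereDiamondFour_toReal,
    BoltzmannB4.volume_hardSphereStarFour_toReal]
  have hπ : Real.pi ≠ 0 := Real.pi_ne_zero
  field_simp
  ring


end Literature.MathematicalPhysics.StatisticalMechanics

end
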